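import Literature.Barriers.FinalStateConjecture.ExtremalHorizonSecondOrderIdentity
import HarnessLib

/-!
# Barrier catalogue `FinalStateConjecture`: the `k = 2` horizon blow-up on extremal Kerr and
# Aretakis's Theorem 3 from the decay of axisymmetric waves `Aretakis2012_pointwiseDecay`
# (`Literature/Barriers/FinalStateConjecture/`, D-0021, D-0014; family `gr`)

`ExtremalHorizonAxisymmetricDecay.lean` vendors the analytic input of Aretakis's Theorem 3
(ATMP 19 (2015)) as a named fact: the pointwise decay of axisymmetric solutions on extremal Kerr
(`Aretakis2012_pointwiseDecay`, Aretakis, JFA 263 (2012), Thm. 5), and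
`ExtremalHorizonInstabilityAssembly.lean` proves Theorem 3 (clauses `k = 1, 2`, universal asymptotic
form, as vendored: the conclusion of `Aretakis2015.scalarInstability_of_facts`) from it and from the
`k = 2` blow-up clause for axisymmetric solutions. This file **proves that clause from the decay
fact**, and hence Theorem 3 from the decay fact alone:

`Aretakis2015.axisymmetricBlowup_of_decay : Aretakis2012_pointwiseDecay → (k = 2 blow-up, axisymmetric ψ)`,
`Aretakis2015.scalarInstability_of_decay : Aretakis2012_pointwiseDecay → (Theorem 3, k = 1, 2)`,

both conclusions spelled out verbatim, so that the vendored Theorem 3 rests on the single analytic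
named fact `Aretakis2012_pointwiseDecay` (the sixty-page vector-field decay theory of the 2012
paper), everything else — the conservation law, the projection to the zeroth azimuthal frequency,
and the blow-up mechanism of Theorem 2 — being proved in this library. (Until the review of
2026-08-15 under D-0026/D-0027 the two conclusions were the named facts
`Aretakis2015_axisymmetricBlowup` and `Aretakis2015_scalarInstability`, pass-through nodes of the
debt census discharged here modulo the leaf; they were merged back into the obligation of the parent
`AretakisInstability` — the `def`s are gone, and the theorems formerly named
`Aretakis2015_axisymmetricBlowup.of_decay`, `Aretakis2015_scalarInstability.of_decay` (dotted names
anchored at those `def`s) are `Aretakis2015.axisymmetricBlowup_of_decay`,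
`Aretakis2015.scalarInstability_of_decay` — and the discharge of Theorem 3, once
`Aretakis2012_pointwiseDecay_holds` exists, is the term
`Aretakis2015.scalarInstability_of_decay Aretakis2012_pointwiseDecay_holds`.)

## The argument (Aretakis 2015, Thm. 2, on extremal Kerr, made quantitative)

Let `Ψ` be a smooth axisymmetric solution near `{r ≥ M} ∩ {t* ≥ 0}` with localised data (globally
represented after the cutoff-and-average of the assembly file), `p_σ(θ, φ)` the points of the horizon
sphere `S_σ`, `T = ∂_{t*}`, `Y = ℓ♯`, and (sphere integrals `∫∫ = ∫₀^{2π}∫₀^π · dθ dφ`, area element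
`2M² sin θ`)
* `H₀ = ∫∫ 2M² sin θ (M sin² θ TΨ + 4M YΨ + 2Ψ)` the conserved charge (`charge_split`,
  from `Aretakis2015_chargeConservation_holds`);
* `G₂(σ) = ∫∫ 2M² sin θ (M² sin² θ TYΨ + 4M² YYΨ + 6M YΨ + 2Ψ)` (`Kerr.secondDensity`).
Then:
1. `G₂(b) − G₂(a) = −4M² ∫_a^b ∫∫ sin θ · YΨ` (`secondIntegral_evolution`): the `T`-antiderivative of
   `Y(ρ² □_g ψ)|_{𝓗⁺} = 0` integrated over the spheres (`Kerr.hasDerivAt_secondDensity_of_wave`,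
   `Kerr.sphereIntegral_eq_add_source`), Aretakis's `∫∫ V(f[ψ, Dψ, DDψ]) + ∫∫ Yψ = 0`;
2. `∫∫ [4M² sin³ θ TYΨ + M sin³ θ (M sin² θ TTΨ + 2TΨ)] = −∫∫ (4 sin θ cos² θ − 2 sin³ θ) Ψ`
   (`static_identity`): the wave equation on the horizon, `ρ² □_g ψ|_{𝓗⁺} = M² sin² θ TTψ + 4M² TYψ +
   2M Tψ + 2MΦ(Tψ + Yψ) + ∆_{S²}ψ = 0`, integrated against `sin² θ` (two integrations by parts of
   `sin² θ ∆_{S²}`); this is the observation that **the mixed derivative `TYψ` is controlled on `𝓗⁺` by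
   `ψ, Tψ, TTψ` alone**, so that no boundedness of `Yψ`, `TYψ` along the horizon is needed;
3. `G₂ = 8M⁴ ∫∫ sin θ YYΨ + 2M⁴ ∫∫ sin³ θ TYΨ + 12M³ ∫∫ sin θ YΨ + 4M² ∫∫ sin θ Ψ`
   (`secondIntegral_split`).
By the decay fact applied to `Ψ, TΨ, TTΨ` (the class is closed under `T`, `Kerr.timeDeriv_in_class`),
`|Ψ|, |TΨ|, |TTΨ| ≤ ε` on `S_σ` for `σ ≥ τ₀`; with `ε = |H₀|/(32πM²(M + 2))`: `|8M³ ∫∫ sin θ YΨ − H₀| ≤ |H₀|/4`,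
hence by 1. `|G₂(τ) − G₂(τ₀) + (H₀/2M)(τ − τ₀)| ≤ (|H₀|/8M)(τ − τ₀)`, and by 2.–3.
`8M⁴ |∫∫ sin θ YYΨ| ≥ |G₂(τ)| − K|…|`; since `|∫∫ sin θ YYΨ| ≤ 4π sup_{S_τ} |YYΨ|`, for
`τ ≥ τ₁ = (3/2)τ₀ + (4M/|H₀|)(|G₂(τ₀)| + K)` some point of `S_τ` has `|YYΨ| ≥ |H₀| τ/(256 π M⁵)`
(`Kerr.secondDeriv_blowup_core`). The transfer to a general (non-globally-represented) axisymmetric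
solution of the class goes through the cutoff average of `ExtremalHorizonAxisymmetricProjection.lean`
(`YYψ₀ = ∫ (YYψ) ∘ R_α`, `H₀[ψ₀] = 2π H₀[ψ]`), with the constant `c = 1/(256 π M⁵)`.

Supporting lemmas: the derivative of the coordinate wave expression in an arbitrary direction
(`fderiv_waveCoord_apply`) and its vanishing for solutions (`waveCoord_and_fderiv_eq_zero`),
`YYΦ = D²Φ(ℓ♯, ℓ♯)` (`fderiv_transversal_nullVector`, geodesy of the null lines), sphere-integral
bookkeeping for continuous integrands.

## References

* S. Aretakis, *Horizon instability of extremal black holes*, Adv. Theor. Math. Phys. 19 (2015)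
  507–530 (arXiv:1206.6598): Thm. 2 (Blow-up) and its proof, p. 10; §5.2 (ρ² □_g, the conserved
  `H₀^{Kerr}`, "restricting `Y(ρ² □_g ψ) = 0` on `𝓗`"), Thm. 3 (k = 2 clause), p. 12 (key `Aretakis2015`).
* S. Aretakis, *Decay of axisymmetric solutions of the wave equation on extreme Kerr backgrounds*,
  J. Funct. Anal. 263 (2012) 2770–2831, §3, Thm. 5 (key `Aretakis2012`).
* R. P. Kerr, A. Schild, 1965, §2 (key `KerrSchild1965`); B. O'Neill, *The geometry of Kerr black
  holes*, 1995, Ch. 2 §2.2 (key `ONeill1995`).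
-/

noncomputable section

open Set Filter MeasureTheory intervalIntegral
open scoped Topology ContDiff Manifold

namespace Literature.Barriers.FinalStateConjecture.Kerr

open Literature.Geometry.Lorentzian

/-! ### The derivative of the coordinate wave expression along an arbitrary vector -/

/-- **The derivative of the coordinate wave expression.** For `Φ` smooth on `E4`, at a point with
`r > 0` and for every vector `v`:
`∂_v (∑ g^{μν} ∂_μ∂_ν Φ + ∑ c^ν ∂_ν Φ) = ∑ (∂_v g^{μν}) ∂_μ∂_νΦ + ∑ g^{μν} D³Φ(v,∂_μ,∂_ν)
  + ∑ (∂_v c^ν) ∂_νΦ + ∑ c^ν D²Φ(v, ∂_ν)` (product rule). [cite: KerrSchild1965, §2] -/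
theorem fderiv_waveCoord_apply (M a : ℝ) {Φ : E4 → ℝ} (hΦ : ContDiff ℝ ∞ Φ) {z : E4}
    (hz : 0 < Kerr.radius a z) (v : E4) :
    fderiv ℝ (fun y ↦ ∑ μ, ∑ ν, Kerr.inverseMetric M a y μ ν *
        fderiv ℝ (fderiv ℝ Φ) y (E4.basisVector μ) (E4.basisVector ν) +
      ∑ ν, Kerr.divInverseMetric M a y ν * fderiv ℝ Φ y (E4.basisVector ν)) z v =
    ∑ μ, ∑ ν, fderiv ℝ (fun y ↦ Kerr.inverseMetric M a y μ ν) z v *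
        fderiv ℝ (fderiv ℝ Φ) z (E4.basisVector μ) (E4.basisVector ν) +
      ∑ μ, ∑ ν, Kerr.inverseMetric M a z μ ν *
        fderiv ℝ (fderiv ℝ (fderiv ℝ Φ)) z v (E4.basisVector μ) (E4.basisVector ν) +
      ∑ ν, fderiv ℝ (fun y ↦ Kerr.divInverseMetric M a y ν) z v * fderiv ℝ Φ z (E4.basisVector ν) +
      ∑ ν, Kerr.divInverseMetric M a z ν * fderiv ℝ (fderiv ℝ Φ) z v (E4.basisVector ν) := by
  have h1 : ContDiff ℝ ∞ (fderiv ℝ Φ) := hΦ.fderiv_right (m := ∞) le_rfl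
  have h2 : ContDiff ℝ ∞ (fderiv ℝ (fderiv ℝ Φ)) := h1.fderiv_right (m := ∞) le_rfl
  have hd1 : Differentiable ℝ (fderiv ℝ Φ) := h1.differentiable (WithTop.coe_ne_zero.mpr ENat.top_ne_zero)
  have hd2 : Differentiable ℝ (fderiv ℝ (fderiv ℝ Φ)) := h2.differentiable (WithTop.coe_ne_zero.mpr ENat.top_ne_zero)
  have hg : ∀ μ ν, HasFDerivAt (fun y ↦ Kerr.inverseMetric M a y μ ν)
      (fderiv ℝ (fun y ↦ Kerr.inverseMetric M a y μ ν) z) z := fun μ ν ↦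
    ((Kerr.contDiffAt_inverseMetric M a hz μ ν (n := 1)).differentiableAt one_ne_zero).hasFDerivAt
  have hc : ∀ ν, HasFDerivAt (fun y ↦ Kerr.divInverseMetric M a y ν)
      (fderiv ℝ (fun y ↦ Kerr.divInverseMetric M a y ν) z) z := fun ν ↦
    ((contDiffAt_divInverseMetric M a hz ν (n := 1)).differentiableAt one_ne_zero).hasFDerivAt
  have hB : ∀ μ ν, HasFDerivAt (fun y ↦ fderiv ℝ (fderiv ℝ Φ) y (E4.basisVector μ) (E4.basisVector ν))
      (fderiv ℝ (fun y ↦ fderiv ℝ (fderiv ℝ Φ) y (E4.basisVector μ) (E4.basisVector ν)) z) z := by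
    intro μ ν
    have h := ((hd2 z).hasFDerivAt.clm_apply (hasFDerivAt_const (E4.basisVector μ) z))
    exact (h.clm_apply (hasFDerivAt_const (E4.basisVector ν) z)).differentiableAt.hasFDerivAt
  have hBv : ∀ μ ν, fderiv ℝ (fun y ↦ fderiv ℝ (fderiv ℝ Φ) y (E4.basisVector μ) (E4.basisVector ν)) z v =
      fderiv ℝ (fderiv ℝ (fderiv ℝ Φ)) z v (E4.basisVector μ) (E4.basisVector ν) := by
    intro μ ν
    rw [fderiv_clm_apply_const_apply (c := fun y ↦ fderiv ℝ (fderiv ℝ Φ) y (E4.basisVector μ)) ?_,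
      fderiv_clm_apply_const_apply (hd2 z)]
    exact ((hd2 z).hasFDerivAt.clm_apply (hasFDerivAt_const (E4.basisVector μ) z)).differentiableAt
  have hL : ∀ ν, HasFDerivAt (fun y ↦ fderiv ℝ Φ y (E4.basisVector ν))
      ((fderiv ℝ (fderiv ℝ Φ) z).flip (E4.basisVector ν)) z := fun ν ↦ by
    simpa using (hd1 z).hasFDerivAt.clm_apply (hasFDerivAt_const (E4.basisVector ν) z)
  have hsum := (HasFDerivAt.fun_sum fun μ (_ : μ ∈ Finset.univ) ↦
    HasFDerivAt.fun_sum fun ν (_ : ν ∈ Finset.univ) ↦ (hg μ ν).mul (hB μ ν)).add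
    (HasFDerivAt.fun_sum fun ν (_ : ν ∈ Finset.univ) ↦ (hc ν).mul (hL ν))
  rw [show (fun y ↦ ∑ μ, ∑ ν, Kerr.inverseMetric M a y μ ν *
        fderiv ℝ (fderiv ℝ Φ) y (E4.basisVector μ) (E4.basisVector ν) +
      ∑ ν, Kerr.divInverseMetric M a y ν * fderiv ℝ Φ y (E4.basisVector ν)) =
      ((fun y ↦ ∑ μ, ∑ ν, ((fun y ↦ Kerr.inverseMetric M a y μ ν) * fun y ↦
        fderiv ℝ (fderiv ℝ Φ) y (E4.basisVector μ) (E4.basisVector ν)) y) + fun y ↦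
        ∑ ν, ((fun y ↦ Kerr.divInverseMetric M a y ν) * fun y ↦ fderiv ℝ Φ y (E4.basisVector ν)) y)
      from rfl, hsum.fderiv]
  simp only [FunLike.coe_add, Pi.add_apply, FunLike.coe_sum, Finset.sum_apply, FunLike.coe_smul,
    Pi.smul_apply, smul_eq_mul, hBv, ContinuousLinearMap.flip_apply, Finset.sum_add_distrib]
  have e1 : ∑ μ, ∑ ν, fderiv ℝ (fderiv ℝ Φ) z (E4.basisVector μ) (E4.basisVector ν) *
      fderiv ℝ (fun y ↦ Kerr.inverseMetric M a y μ ν) z v =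
      ∑ μ, ∑ ν, fderiv ℝ (fun y ↦ Kerr.inverseMetric M a y μ ν) z v *
        fderiv ℝ (fderiv ℝ Φ) z (E4.basisVector μ) (E4.basisVector ν) :=
    Finset.sum_congr rfl fun μ _ ↦ Finset.sum_congr rfl fun ν _ ↦ mul_comm _ _
  have e2 : ∑ ν, fderiv ℝ Φ z (E4.basisVector ν) * fderiv ℝ (fun y ↦ Kerr.divInverseMetric M a y ν) z v =
      ∑ ν, fderiv ℝ (fun y ↦ Kerr.divInverseMetric M a y ν) z v * fderiv ℝ Φ z (E4.basisVector ν) :=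
    Finset.sum_congr rfl fun ν _ ↦ mul_comm _ _
  rw [e1, e2]
  ring

/-- **The wave expression and its derivative vanish where a solution is smooth.** If `Φ` is smooth
on `E4` and the chart function `y ↦ Φ y` solves `□_g = 0` on an open set `U₀` of the chart, then at
each `x ∈ U₀` the coordinate wave expression `W₁[Φ]` vanishes together with its derivative in every
direction (it vanishes on the open set over `U₀`). [cite: KerrSchild1965, §2] -/
theorem waveCoord_and_fderiv_eq_zero [Kerr.Facts] [Kerr.SliceFacts] {M r₀ : ℝ} {Φ : E4 → ℝ}
    (hΦ : ContDiff ℝ ∞ Φ) {U₀ : Set (Kerr.region M r₀)} (hU₀ : IsOpen U₀)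
    (hsol : ∀ x ∈ U₀, (Kerr.smoothMetric M M r₀).toPseudoRiemannianMetric.dalembertian
      (fun y : Kerr.region M r₀ ↦ Φ y) x = 0) (x : Kerr.region M r₀) (hx : x ∈ U₀) (v : E4) :
    (∑ μ, ∑ ν, Kerr.inverseMetric M M x μ ν *
        fderiv ℝ (fderiv ℝ Φ) x (E4.basisVector μ) (E4.basisVector ν) +
      ∑ ν, Kerr.divInverseMetric M M x ν * fderiv ℝ Φ x (E4.basisVector ν) = 0) ∧
    (∑ μ, ∑ ν, fderiv ℝ (fun y ↦ Kerr.inverseMetric M M y μ ν) x v *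
        fderiv ℝ (fderiv ℝ Φ) x (E4.basisVector μ) (E4.basisVector ν) +
      ∑ μ, ∑ ν, Kerr.inverseMetric M M x μ ν *
        fderiv ℝ (fderiv ℝ (fderiv ℝ Φ)) x v (E4.basisVector μ) (E4.basisVector ν) +
      ∑ ν, fderiv ℝ (fun y ↦ Kerr.divInverseMetric M M y ν) x v * fderiv ℝ Φ x (E4.basisVector ν) +
      ∑ ν, Kerr.divInverseMetric M M x ν * fderiv ℝ (fderiv ℝ Φ) x v (E4.basisVector ν) = 0) := by
  have hxpos : 0 < Kerr.radius M x := Kerr.radius_pos_of_mem_region x.2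
  set E : E4 → ℝ := fun y ↦ ∑ μ, ∑ ν, Kerr.inverseMetric M M y μ ν *
      fderiv ℝ (fderiv ℝ Φ) y (E4.basisVector μ) (E4.basisVector ν) +
    ∑ ν, Kerr.divInverseMetric M M y ν * fderiv ℝ Φ y (E4.basisVector ν) with hE
  have hopen : IsOpen (Subtype.val '' U₀ : Set E4) :=
    (Kerr.region M r₀).isOpen.isOpenMap_subtype_val U₀ hU₀
  have hzero : EqOn E (fun _ ↦ 0) (Subtype.val '' U₀) := by
    rintro _ ⟨y, hyU, rfl⟩
    have h := hsol y hyU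
    rwa [dalembertian_eq_hessian_add_firstOrder M M r₀ (ψ := fun y : Kerr.region M r₀ ↦ Φ y) (Φ := Φ)
      (fun _ ↦ rfl) y (hΦ.contDiffAt.of_le (WithTop.coe_le_coe.mpr le_top))] at h
  refine ⟨hzero ⟨x, hx, rfl⟩, ?_⟩
  rw [← fderiv_waveCoord_apply M M hΦ hxpos v]
  have h := fderiv_eq_of_eqOn_isOpen hopen hzero ⟨x, hx, rfl⟩
  show fderiv ℝ E x v = 0
  rw [h]
  simp

/-! ### The second transversal derivative of a globally represented function -/

/-- **`YYΦ = D²Φ(ℓ♯, ℓ♯)`** where `r > 0`: the derivative along `ℓ♯` of `w ↦ DΦ(w)(ℓ♯_w)` is the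
Hessian on `(ℓ♯, ℓ♯)`, the null lines being straight (`∂_{ℓ♯} ℓ♯ = 0`). [cite: KerrSchild1965, §2] -/
theorem fderiv_transversal_nullVector {a : ℝ} {Φ : E4 → ℝ} (hΦ : ContDiff ℝ ∞ Φ) {z : E4}
    (hz : 0 < Kerr.radius a z) :
    fderiv ℝ (fun w ↦ fderiv ℝ Φ w (Kerr.nullVector a w)) z (Kerr.nullVector a z) =
      fderiv ℝ (fderiv ℝ Φ) z (Kerr.nullVector a z) (Kerr.nullVector a z) := by
  have h1 : ContDiff ℝ ∞ (fderiv ℝ Φ) := hΦ.fderiv_right (m := ∞) le_rfl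
  have hd1 : Differentiable ℝ (fderiv ℝ Φ) := h1.differentiable (WithTop.coe_ne_zero.mpr ENat.top_ne_zero)
  -- expand `DΦ(w)(ℓ♯_w) = ∑ ℓ♯_w^μ ∂_μ Φ(w)`
  have hfun : (fun w ↦ fderiv ℝ Φ w (Kerr.nullVector a w)) =
      fun w ↦ ∑ μ, ((fun w ↦ Kerr.nullVector a w μ) * fun w ↦ fderiv ℝ Φ w (E4.basisVector μ)) w := by
    funext w
    rw [lin_eq_sum (fderiv ℝ Φ w) (Kerr.nullVector a w)]
    simp only [Pi.mul_apply]
  have hV : ∀ μ, HasFDerivAt (fun w ↦ Kerr.nullVector a w μ) (fderiv ℝ (fun w ↦ Kerr.nullVector a w μ) z) z :=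
    fun μ ↦ ((contDiffAt_euclidean.mp (Kerr.contDiffAt_nullVector a hz (n := 1)) μ).differentiableAt
      one_ne_zero).hasFDerivAt
  have hL : ∀ μ, HasFDerivAt (fun y ↦ fderiv ℝ Φ y (E4.basisVector μ))
      ((fderiv ℝ (fderiv ℝ Φ) z).flip (E4.basisVector μ)) z := fun μ ↦ by
    simpa using (hd1 z).hasFDerivAt.clm_apply (hasFDerivAt_const (E4.basisVector μ) z)
  have hsum := HasFDerivAt.fun_sum fun μ (_ : μ ∈ Finset.univ) ↦ (hV μ).mul (hL μ)
  rw [hfun, hsum.fderiv]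
  simp only [FunLike.coe_sum, Finset.sum_apply, FunLike.coe_add, Pi.add_apply, FunLike.coe_smul,
    Pi.smul_apply, smul_eq_mul, ContinuousLinearMap.flip_apply, Kerr.fderiv_nullVector_apply_nullVector hz,
    mul_zero, add_zero]
  rw [lin_eq_sum (fderiv ℝ (fderiv ℝ Φ) z (Kerr.nullVector a z)) (Kerr.nullVector a z)]

/-- **The second transversal derivative of a chart function with a smooth global representative**:
`YY(Φ ∘ val)(x) = D²Φ(x)(ℓ♯, ℓ♯)`. [folklore] -/
theorem transversalDeriv_transversalDeriv_of_rep {M r₀ : ℝ} {Φ : E4 → ℝ} (hΦ : ContDiff ℝ ∞ Φ)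
    (x : Kerr.region M r₀) :
    transversalDeriv M r₀ (transversalDeriv M r₀ (fun y : Kerr.region M r₀ ↦ Φ y)) x =
      fderiv ℝ (fderiv ℝ Φ) x (Kerr.nullVector M x) (Kerr.nullVector M x) := by
  have hd0 : Differentiable ℝ Φ := hΦ.differentiable (WithTop.coe_ne_zero.mpr ENat.top_ne_zero)
  have h1 : ContDiff ℝ ∞ (fderiv ℝ Φ) := hΦ.fderiv_right (m := ∞) le_rfl
  have hxpos : 0 < Kerr.radius M x := Kerr.radius_pos_of_mem_region x.2
  have hY : transversalDeriv M r₀ (fun y : Kerr.region M r₀ ↦ Φ y) =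
      fun y : Kerr.region M r₀ ↦ fderiv ℝ Φ y (Kerr.nullVector M y) :=
    funext fun y ↦ transversalDeriv_of_rep hd0 y
  rw [hY, transversalDeriv_apply, OpensChart.mfderiv_eq x
    (fun y : Kerr.region M r₀ ↦ fderiv ℝ Φ y (Kerr.nullVector M y))
    (fun w ↦ fderiv ℝ Φ w (Kerr.nullVector M w)) (fun _ ↦ rfl) ?_]
  · exact fderiv_transversal_nullVector hΦ hxpos
  · exact ((h1.contDiffAt (x := (x : E4))).clm_apply (Kerr.contDiffAt_nullVector M hxpos)).differentiableAt
      (WithTop.coe_ne_zero.mpr ENat.top_ne_zero)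

/-! ### The class of smooth axisymmetric localised solutions is closed under `T = ∂_{t*}` -/

/-- **`T`-closure of the class (global representatives).** If `Φ` is smooth on `E4`, axisymmetric,
solves `□_g = 0` as a chart function on the open `U₀` and is localised on the leaf together with
`DΦ`, then the same holds for `TΦ = ∂_{t*}Φ`. [cite: ONeill1995, Ch. 2 §2.2] -/
theorem timeDeriv_in_class [Kerr.Facts] [Kerr.SliceFacts] {M r₀ : ℝ} (hM : 0 ≤ M) {Φ : E4 → ℝ}
    (hΦ : ContDiff ℝ ∞ Φ) {U₀ : Set (Kerr.region M r₀)} (hU₀ : IsOpen U₀)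
    (hsol : ∀ x ∈ U₀, (Kerr.smoothMetric M M r₀).toPseudoRiemannianMetric.dalembertian
      (fun y : Kerr.region M r₀ ↦ Φ y) x = 0)
    {ρ : ℝ} (hloc : ∀ x ∈ U₀, (x : E4) 0 = 0 → ρ < E4.spatialNorm (x : E4) → Φ x = 0 ∧ fderiv ℝ Φ x = 0)
    (haxi : ∀ β x, Φ (E4.axialRotation β x) = Φ x) :
    ContDiff ℝ ∞ (fun y ↦ fderiv ℝ Φ y (E4.basisVector 0)) ∧
    (∀ x ∈ U₀, (Kerr.smoothMetric M M r₀).toPseudoRiemannianMetric.dalembertian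
      (fun y : Kerr.region M r₀ ↦ fderiv ℝ Φ y (E4.basisVector 0)) x = 0) ∧
    (∀ x ∈ U₀, (x : E4) 0 = 0 → ρ < E4.spatialNorm (x : E4) →
      fderiv ℝ Φ x (E4.basisVector 0) = 0 ∧ fderiv ℝ (fun y ↦ fderiv ℝ Φ y (E4.basisVector 0)) x = 0) ∧
    (∀ β x, fderiv ℝ Φ (E4.axialRotation β x) (E4.basisVector 0) = fderiv ℝ Φ x (E4.basisVector 0)) :=
  ⟨(hΦ.fderiv_right (m := ∞) le_rfl).clm_apply contDiff_const,
    fun x hx ↦ dalembertian_timeDeriv_eq_zero hΦ hU₀ hsol x hx,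
    fun x hx hx0 hxρ ↦ timeDeriv_localised hM hΦ hU₀ hsol hloc x hx hx0 hxρ,
    fun β x ↦ fderiv_basisVector_zero_axialRotation
      (hΦ.differentiable (WithTop.coe_ne_zero.mpr ENat.top_ne_zero)) haxi β x⟩

/-- **Application of the decay fact to a globally represented member of the class**: for every
`ε > 0` there is `τ₁` such that `|Φ| ≤ ε` at all points `p_σ(θ, φ)` of the horizon spheres `S_σ`,
`σ ≥ τ₁`. [cite: Aretakis2012, Thm. 5] -/
theorem decay_at_horizonPoint (hDec : Aretakis2012_pointwiseDecay) [Kerr.Facts] [Kerr.SliceFacts]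
    {M : ℝ} (hM : 0 < M) {r₀ : ℝ} (hr₀ : r₀ ∈ Set.Ioo 0 M) {U₀ : Set (Kerr.region M r₀)} (hU₀ : IsOpen U₀)
    (hKU₀ : {x : Kerr.region M r₀ | Kerr.rPlus M M ≤ Kerr.radius M (x : E4) ∧ 0 ≤ (x : E4) 0} ⊆ U₀)
    {Φ : E4 → ℝ} (hΦ : ContDiff ℝ ∞ Φ)
    (hsol : ∀ x ∈ U₀, (Kerr.smoothMetric M M r₀).toPseudoRiemannianMetric.dalembertian
      (fun y : Kerr.region M r₀ ↦ Φ y) x = 0)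
    {ρ : ℝ} (hloc : ∀ x ∈ U₀, (x : E4) 0 = 0 → ρ < E4.spatialNorm (x : E4) → Φ x = 0 ∧ fderiv ℝ Φ x = 0)
    (haxi : ∀ β x, Φ (E4.axialRotation β x) = Φ x) {ε : ℝ} (hε : 0 < ε) :
    ∃ τ₁ : ℝ, ∀ σ : ℝ, τ₁ ≤ σ → ∀ θ φ, |Φ (horizonPoint M σ θ φ)| ≤ ε := by
  obtain ⟨hr₀pos, hr₀M⟩ := hr₀
  set f : Kerr.region M r₀ → ℝ := fun y ↦ Φ y with hfdef
  have hf : ContMDiffOn 𝓘(ℝ, E4) 𝓘(ℝ, ℝ) ∞ f U₀ := fun y _ ↦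
    ((OpensChart.contMDiffAt_iff y f Φ (fun _ ↦ rfl)).mpr hΦ.contDiffAt).contMDiffWithinAt
  have hlocm : ∃ ρ' : ℝ, ∀ x ∈ U₀, (x : E4) 0 = 0 → ρ' < E4.spatialNorm (x : E4) →
      f x = 0 ∧ mfderiv 𝓘(ℝ, E4) 𝓘(ℝ, ℝ) f x = 0 := by
    refine ⟨ρ, fun x hx hx0 hxρ ↦ ⟨(hloc x hx hx0 hxρ).1, ?_⟩⟩
    rw [OpensChart.mfderiv_eq x f Φ (fun _ ↦ rfl) (hΦ.differentiable (WithTop.coe_ne_zero.mpr ENat.top_ne_zero) _)]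
    exact (hloc x hx hx0 hxρ).2
  have haxif : IsAxisymmetric f := fun α x ↦ haxi α x
  obtain ⟨τ₁, hτ₁⟩ := hDec M hM r₀ ⟨hr₀pos, hr₀M⟩ U₀ f hU₀ hKU₀ hf hsol hlocm haxif ε hε
  refine ⟨τ₁, fun σ hσ θ φ ↦ ?_⟩
  have hp : horizonPoint M σ θ φ ∈ Kerr.region M r₀ := horizonPoint_mem_region hM hr₀M σ θ φ
  have hpS : (⟨_, hp⟩ : Kerr.region M r₀) ∈ horizonSection M M r₀ σ := by
    rw [mem_horizonSection]
    exact ⟨by rw [rPlus_self]; exact radius_horizonPoint hM.le σ θ φ, horizonPoint_apply_zero M σ θ φ⟩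
  exact hτ₁ σ hσ ⟨_, hp⟩ hpS

/-! ### Linear operations on sphere integrals of continuous functions -/

/-- Additivity of the iterated sphere integral for jointly continuous integrands. [folklore] -/
theorem sphereIntegral_add {f g : ℝ → ℝ → ℝ} (hf : Continuous (Function.uncurry f))
    (hg : Continuous (Function.uncurry g)) :
    ∫ φ in (0 : ℝ)..2 * Real.pi, ∫ θ in (0 : ℝ)..Real.pi, (f θ φ + g θ φ) =
      (∫ φ in (0 : ℝ)..2 * Real.pi, ∫ θ in (0 : ℝ)..Real.pi, f θ φ) +
        ∫ φ in (0 : ℝ)..2 * Real.pi, ∫ θ in (0 : ℝ)..Real.pi, g θ φ := by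
  have hf_θ : ∀ φ, Continuous fun θ ↦ f θ φ := fun φ ↦ hf.comp (Continuous.prodMk continuous_id continuous_const)
  have hg_θ : ∀ φ, Continuous fun θ ↦ g θ φ := fun φ ↦ hg.comp (Continuous.prodMk continuous_id continuous_const)
  have hinner : ∀ φ, ∫ θ in (0 : ℝ)..Real.pi, (f θ φ + g θ φ) =
      (∫ θ in (0 : ℝ)..Real.pi, f θ φ) + ∫ θ in (0 : ℝ)..Real.pi, g θ φ := by
    intro φ
    have i1 : IntervalIntegrable (fun θ ↦ f θ φ) volume 0 Real.pi := (hf_θ φ).intervalIntegrable _ _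
    have i2 : IntervalIntegrable (fun θ ↦ g θ φ) volume 0 Real.pi := (hg_θ φ).intervalIntegrable _ _
    exact intervalIntegral.integral_add i1 i2
  simp only [hinner]
  have hIf : Continuous fun φ ↦ ∫ θ in (0 : ℝ)..Real.pi, f θ φ := by
    have h : Continuous (Function.uncurry fun φ θ ↦ f θ φ) := hf.comp (Continuous.prodMk continuous_snd continuous_fst)
    exact intervalIntegral.continuous_parametric_intervalIntegral_of_continuous' h 0 Real.pi
  have hIg : Continuous fun φ ↦ ∫ θ in (0 : ℝ)..Real.pi, g θ φ := by
    have h : Continuous (Function.uncurry fun φ θ ↦ g θ φ) := hg.comp (Continuous.prodMk continuous_snd continuous_fst)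
    exact intervalIntegral.continuous_parametric_intervalIntegral_of_continuous' h 0 Real.pi
  have j1 : IntervalIntegrable (fun φ ↦ ∫ θ in (0 : ℝ)..Real.pi, f θ φ) volume 0 (2 * Real.pi) :=
    hIf.intervalIntegrable _ _
  have j2 : IntervalIntegrable (fun φ ↦ ∫ θ in (0 : ℝ)..Real.pi, g θ φ) volume 0 (2 * Real.pi) :=
    hIg.intervalIntegrable _ _
  exact intervalIntegral.integral_add j1 j2

/-- Constants come out of the iterated sphere integral. [folklore] -/
theorem sphereIntegral_const_mul (c : ℝ) (f : ℝ → ℝ → ℝ) :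
    ∫ φ in (0 : ℝ)..2 * Real.pi, ∫ θ in (0 : ℝ)..Real.pi, c * f θ φ =
      c * ∫ φ in (0 : ℝ)..2 * Real.pi, ∫ θ in (0 : ℝ)..Real.pi, f θ φ := by
  simp only [intervalIntegral.integral_const_mul]

/-! ### The integral identities on the horizon spheres for a smooth solution -/

/-- Continuity on a sphere `S_σ`, `σ ≥ 0`, of a clamped jointly continuous expression. [folklore] -/
theorem continuous_angles_of_clamp {K : ℝ → ℝ → ℝ → ℝ}
    (hK : Continuous fun q : ℝ × ℝ × ℝ ↦ K (max q.1 0) q.2.1 q.2.2) {σ : ℝ} (hσ : 0 ≤ σ) :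
    Continuous (Function.uncurry fun θ φ ↦ K σ θ φ) := by
  have h := hK.comp (Continuous.prodMk continuous_const continuous_id :
    Continuous fun q : ℝ × ℝ ↦ ((σ, q) : ℝ × ℝ × ℝ))
  rw [Function.uncurry_def]
  exact h.congr fun q ↦ by simp only [Function.comp_apply, max_eq_left hσ]

/-- Generic joint continuity: a trigonometric-polynomial weight times a smooth function, its
differential or its Hessian at the clamped horizon point, applied to frame vectors. [folklore] -/
theorem continuous_clamp_terms {M : ℝ} {Ψ : E4 → ℝ} (hΨ : ContDiff ℝ ∞ Ψ) :
    (Continuous fun q : ℝ × ℝ × ℝ ↦ Ψ (horizonPoint M (max q.1 0) q.2.1 q.2.2)) ∧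
    (Continuous fun q : ℝ × ℝ × ℝ ↦ fderiv ℝ Ψ (horizonPoint M (max q.1 0) q.2.1 q.2.2) (E4.basisVector 0)) ∧
    (Continuous fun q : ℝ × ℝ × ℝ ↦
      fderiv ℝ Ψ (horizonPoint M (max q.1 0) q.2.1 q.2.2) (horizonNull q.2.1 q.2.2)) ∧
    (Continuous fun q : ℝ × ℝ × ℝ ↦
      fderiv ℝ (fderiv ℝ Ψ) (horizonPoint M (max q.1 0) q.2.1 q.2.2) (E4.basisVector 0) (E4.basisVector 0)) ∧
    (Continuous fun q : ℝ × ℝ × ℝ ↦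
      fderiv ℝ (fderiv ℝ Ψ) (horizonPoint M (max q.1 0) q.2.1 q.2.2) (E4.basisVector 0) (horizonNull q.2.1 q.2.2)) ∧
    (Continuous fun q : ℝ × ℝ × ℝ ↦
      fderiv ℝ (fderiv ℝ Ψ) (horizonPoint M (max q.1 0) q.2.1 q.2.2) (horizonNull q.2.1 q.2.2)
        (horizonNull q.2.1 q.2.2)) := by
  have hP := continuous_horizonPoint_clamp M
  obtain ⟨hN, -, -, -, -, -, -, -, -⟩ := continuous_frames (M := M)
  have h1c : ContDiff ℝ ∞ (fderiv ℝ Ψ) := hΨ.fderiv_right (m := ∞) le_rfl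
  have hΨq : Continuous fun q : ℝ × ℝ × ℝ ↦ Ψ (horizonPoint M (max q.1 0) q.2.1 q.2.2) :=
    hΨ.continuous.comp hP
  have hLq : Continuous fun q : ℝ × ℝ × ℝ ↦ fderiv ℝ Ψ (horizonPoint M (max q.1 0) q.2.1 q.2.2) :=
    (hΨ.continuous_fderiv (WithTop.coe_ne_zero.mpr ENat.top_ne_zero)).comp hP
  have hBq : Continuous fun q : ℝ × ℝ × ℝ ↦ fderiv ℝ (fderiv ℝ Ψ) (horizonPoint M (max q.1 0) q.2.1 q.2.2) :=
    (h1c.continuous_fderiv (WithTop.coe_ne_zero.mpr ENat.top_ne_zero)).comp hP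
  exact ⟨hΨq, hLq.clm_apply continuous_const, hLq.clm_apply hN,
    (hBq.clm_apply continuous_const).clm_apply continuous_const,
    (hBq.clm_apply continuous_const).clm_apply hN, (hBq.clm_apply hN).clm_apply hN⟩

section SolutionIdentities

variable [Kerr.Facts] [Kerr.SliceFacts] {M r₀ : ℝ} {U₀ : Set (Kerr.region M r₀)} {Ψ : E4 → ℝ}

/-- **The charge identity split**: for a smooth solution on `U₀ ⊇ {r ≥ M} ∩ {t* ≥ 0}` and `σ ≥ 0`,
`H₀[Ψ] = ∫∫ 2M² sin θ (M sin² θ TΨ + 2Ψ)(p_σ) + 8M³ ∫∫ sin θ · YΨ(p_σ)` (conservation of `H₀`,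
`Aretakis2015_chargeConservation_holds`). [cite: Aretakis2015, §5.2 and Prop. 5.1] -/
theorem charge_split (hM : 0 < M) (hr₀ : r₀ ∈ Set.Ioo 0 M) (hU₀ : IsOpen U₀)
    (hKU₀ : {x : Kerr.region M r₀ | Kerr.rPlus M M ≤ Kerr.radius M (x : E4) ∧ 0 ≤ (x : E4) 0} ⊆ U₀)
    (hΨ : ContDiff ℝ ∞ Ψ)
    (hsol : ∀ x ∈ U₀, (Kerr.smoothMetric M M r₀).toPseudoRiemannianMetric.dalembertian
      (fun y : Kerr.region M r₀ ↦ Ψ y) x = 0) {σ : ℝ} (hσ : 0 ≤ σ) :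
    aretakisCharge M r₀ (fun y : Kerr.region M r₀ ↦ Ψ y) =
      (∫ φ in (0 : ℝ)..2 * Real.pi, ∫ θ in (0 : ℝ)..Real.pi,
        2 * M ^ 2 * Real.sin θ * (M * Real.sin θ ^ 2 * fderiv ℝ Ψ (horizonPoint M σ θ φ) (E4.basisVector 0) +
          2 * Ψ (horizonPoint M σ θ φ))) +
      8 * M ^ 3 * ∫ φ in (0 : ℝ)..2 * Real.pi, ∫ θ in (0 : ℝ)..Real.pi,
        Real.sin θ * fderiv ℝ Ψ (horizonPoint M σ θ φ) (horizonNull θ φ) := by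
  obtain ⟨hr₀pos, hr₀M⟩ := hr₀
  have hψ : ContMDiffOn 𝓘(ℝ, E4) 𝓘(ℝ, ℝ) ∞ (fun y : Kerr.region M r₀ ↦ Ψ y) U₀ := fun y _ ↦
    ((OpensChart.contMDiffAt_iff y (fun y : Kerr.region M r₀ ↦ Ψ y) Ψ (fun _ ↦ rfl)).mpr hΨ.contDiffAt).contMDiffWithinAt
  have hcons := Aretakis2015_chargeConservation_holds M hM r₀ ⟨hr₀pos, hr₀M⟩ U₀ (fun y : Kerr.region M r₀ ↦ Ψ y)
    hU₀ hKU₀ hψ hsol σ hσ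
  rw [← hcons, aretakisChargeAt_of_rep hM hr₀M Ψ σ, ← sphereIntegral_const_mul (8 * M ^ 3)]
  obtain ⟨h0, hT, hY, -, -, -⟩ := continuous_clamp_terms (M := M) hΨ
  rw [← sphereIntegral_add]
  · refine intervalIntegral.integral_congr fun φ _ ↦ intervalIntegral.integral_congr fun θ _ ↦ ?_
    simp only [densityFun, nullVector_horizonPoint hM]
    ring
  · refine continuous_angles_of_clamp (K := fun σ θ φ ↦ 2 * M ^ 2 * Real.sin θ *
      (M * Real.sin θ ^ 2 * fderiv ℝ Ψ (horizonPoint M σ θ φ) (E4.basisVector 0) + 2 * Ψ (horizonPoint M σ θ φ))) ?_ hσ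
    exact (by fun_prop : Continuous fun q : ℝ × ℝ × ℝ ↦ 2 * M ^ 2 * Real.sin q.2.1).mul
      (((by fun_prop : Continuous fun q : ℝ × ℝ × ℝ ↦ M * Real.sin q.2.1 ^ 2).mul hT).add (continuous_const.mul h0))
  · refine continuous_angles_of_clamp (K := fun σ θ φ ↦ 8 * M ^ 3 *
      (Real.sin θ * fderiv ℝ Ψ (horizonPoint M σ θ φ) (horizonNull θ φ))) ?_ hσ
    exact continuous_const.mul ((by fun_prop : Continuous fun q : ℝ × ℝ × ℝ ↦ Real.sin q.2.1).mul hY)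

/-- **The static identity** (the wave equation on the horizon integrated against `sin² θ`):
`∫∫ [4M² sin³ θ TYΨ + M sin³ θ (M sin² θ TTΨ + 2TΨ)](p_σ) = −∫∫ (4 sin θ cos² θ − 2 sin³ θ) Ψ(p_σ)`
for `σ ≥ 0` (from `Kerr.horizon_density_deriv_identity`, `sin² θ ∆_{S²}` integrated by parts twice).
[cite: Aretakis2015, §5.2 (ρ² □_g on 𝓗⁺) and Prop. 3.1] -/
theorem static_identity (hM : 0 < M) (hr₀ : r₀ ∈ Set.Ioo 0 M) (hU₀ : IsOpen U₀)
    (hKU₀ : {x : Kerr.region M r₀ | Kerr.rPlus M M ≤ Kerr.radius M (x : E4) ∧ 0 ≤ (x : E4) 0} ⊆ U₀)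
    (hΨ : ContDiff ℝ ∞ Ψ)
    (hsol : ∀ x ∈ U₀, (Kerr.smoothMetric M M r₀).toPseudoRiemannianMetric.dalembertian
      (fun y : Kerr.region M r₀ ↦ Ψ y) x = 0) {σ : ℝ} (hσ : 0 ≤ σ) :
    ∫ φ in (0 : ℝ)..2 * Real.pi, ∫ θ in (0 : ℝ)..Real.pi,
      (4 * M ^ 2 * Real.sin θ ^ 3 *
          fderiv ℝ (fderiv ℝ Ψ) (horizonPoint M σ θ φ) (E4.basisVector 0) (horizonNull θ φ) +
        M * Real.sin θ ^ 3 * (M * Real.sin θ ^ 2 *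
            fderiv ℝ (fderiv ℝ Ψ) (horizonPoint M σ θ φ) (E4.basisVector 0) (E4.basisVector 0) +
          2 * fderiv ℝ Ψ (horizonPoint M σ θ φ) (E4.basisVector 0))) =
    ∫ φ in (0 : ℝ)..2 * Real.pi, ∫ θ in (0 : ℝ)..Real.pi,
      -((4 * Real.sin θ * Real.cos θ ^ 2 - 2 * Real.sin θ ^ 3) * Ψ (horizonPoint M σ θ φ)) := by
  obtain ⟨hr₀pos, hr₀M⟩ := hr₀
  have hd0 : Differentiable ℝ Ψ := hΨ.differentiable (WithTop.coe_ne_zero.mpr ENat.top_ne_zero)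
  have hΨ2 : ∀ z, ContDiffAt ℝ 2 Ψ z := fun z ↦ hΨ.contDiffAt.of_le (WithTop.coe_le_coe.mpr le_top)
  -- the wave equation at the horizon points
  have hmem : ∀ θ φ, ∃ hp : horizonPoint M σ θ φ ∈ Kerr.region M r₀, (⟨_, hp⟩ : Kerr.region M r₀) ∈ U₀ := by
    intro θ φ
    refine ⟨horizonPoint_mem_region hM hr₀M σ θ φ, hKU₀ ⟨?_, ?_⟩⟩
    · show Kerr.rPlus M M ≤ Kerr.radius M (horizonPoint M σ θ φ)
      rw [rPlus_self, radius_horizonPoint hM.le]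
    · show 0 ≤ horizonPoint M σ θ φ 0
      rw [horizonPoint_apply_zero]; exact hσ
  have hwave : ∀ θ φ,
      ∑ μ, ∑ ν, Kerr.inverseMetric M M (horizonPoint M σ θ φ) μ ν *
          fderiv ℝ (fderiv ℝ Ψ) (horizonPoint M σ θ φ) (E4.basisVector μ) (E4.basisVector ν) +
        ∑ ν, Kerr.divInverseMetric M M (horizonPoint M σ θ φ) ν *
          fderiv ℝ Ψ (horizonPoint M σ θ φ) (E4.basisVector ν) = 0 := by
    intro θ φ
    obtain ⟨hp, hpU⟩ := hmem θ φ
    exact (waveCoord_and_fderiv_eq_zero hΨ hU₀ hsol ⟨_, hp⟩ hpU 0).1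
  -- the pointwise identity multiplied by `sin² θ`
  have hid : ∀ θ φ, 4 * M ^ 2 * Real.sin θ ^ 3 *
        fderiv ℝ (fderiv ℝ Ψ) (horizonPoint M σ θ φ) (E4.basisVector 0) (horizonNull θ φ) +
      M * Real.sin θ ^ 3 * (M * Real.sin θ ^ 2 *
          fderiv ℝ (fderiv ℝ Ψ) (horizonPoint M σ θ φ) (E4.basisVector 0) (E4.basisVector 0) +
        2 * fderiv ℝ Ψ (horizonPoint M σ θ φ) (E4.basisVector 0)) =
      (-1) * (Real.sin θ ^ 2 * phiFluxDeriv M Ψ σ θ φ +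
          (Real.sin θ ^ 2 * thetaFluxDeriv M Ψ σ θ φ -
            (4 * Real.sin θ * Real.cos θ ^ 2 - 2 * Real.sin θ ^ 3) * Ψ (horizonPoint M σ θ φ))) +
        -((4 * Real.sin θ * Real.cos θ ^ 2 - 2 * Real.sin θ ^ 3) * Ψ (horizonPoint M σ θ φ)) := by
    intro θ φ
    have h := horizon_density_deriv_identity hM σ θ φ (fderiv ℝ (fderiv ℝ Ψ) (horizonPoint M σ θ φ))
      ((hΨ2 _).isSymmSndFDerivAt (by simp)) (fderiv ℝ Ψ (horizonPoint M σ θ φ))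
    rw [hwave θ φ, mul_zero, mul_zero] at h
    simp only [phiFluxDeriv, thetaFluxDeriv]
    linear_combination (Real.sin θ ^ 2) * h
  -- continuity of the pieces
  obtain ⟨h0, hT, hY, hTT, hTY, -⟩ := continuous_clamp_terms (M := M) hΨ
  have hLc : ContinuousOn (fderiv ℝ Ψ) univ := (hΨ.continuous_fderiv (WithTop.coe_ne_zero.mpr ENat.top_ne_zero)).continuousOn
  have hBc : ContinuousOn (fderiv ℝ (fderiv ℝ Ψ)) univ :=
    ((hΨ.fderiv_right (m := ∞) le_rfl).continuous_fderiv (WithTop.coe_ne_zero.mpr ENat.top_ne_zero)).continuousOn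
  have hPV : ∀ σ θ φ, 0 ≤ σ → horizonPoint M σ θ φ ∈ (univ : Set E4) := fun _ _ _ _ ↦ mem_univ _
  have hdEc := continuous_phiFluxDeriv_clamp (M := M) hLc hBc hPV
  have hdTc := continuous_thetaFluxDeriv_clamp (M := M) hLc hBc hPV
  refine sphereIntegral_eq_of_fluxes (E := fun θ φ ↦ Real.sin θ ^ 2 * phiFlux M Ψ σ θ φ)
    (T := fun θ φ ↦ Real.sin θ ^ 2 * thetaFlux M Ψ σ θ φ -
      2 * Real.sin θ ^ 2 * Real.cos θ * Ψ (horizonPoint M σ θ φ))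
    (dE := fun θ φ ↦ Real.sin θ ^ 2 * phiFluxDeriv M Ψ σ θ φ)
    (dT := fun θ φ ↦ Real.sin θ ^ 2 * thetaFluxDeriv M Ψ σ θ φ -
      (4 * Real.sin θ * Real.cos θ ^ 2 - 2 * Real.sin θ ^ 3) * Ψ (horizonPoint M σ θ φ))
    (c := -1) hid ?_ ?_ ?_ ?_ ?_ ?_ ?_ ?_
  · intro θ φ
    exact (hasDerivAt_phiFlux_phi (hΨ2 _)).const_mul _
  · intro θ
    show Real.sin θ ^ 2 * phiFlux M Ψ σ θ (2 * Real.pi) = Real.sin θ ^ 2 * phiFlux M Ψ σ θ 0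
    have h := phiFlux_add_two_pi M Ψ σ θ 0
    rw [zero_add] at h
    rw [h]
  · intro θ φ
    have h1 : HasDerivAt (fun θ' ↦ Real.sin θ' ^ 2) (2 * Real.sin θ * Real.cos θ) θ := by
      have h := (Real.hasDerivAt_sin θ).fun_pow 2
      refine h.congr_deriv ?_
      norm_num
    have h2 := hasDerivAt_thetaFlux_theta (M := M) (σ := σ) (φ := φ) (hΨ2 (horizonPoint M σ θ φ))
    have h3 : HasDerivAt (fun θ' ↦ 2 * Real.sin θ' ^ 2 * Real.cos θ')
        (4 * Real.sin θ * Real.cos θ ^ 2 - 2 * Real.sin θ ^ 3) θ := by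
      have h := (h1.const_mul 2).fun_mul (Real.hasDerivAt_cos θ)
      refine (h.congr_of_eventuallyEq (Eventually.of_forall fun θ' ↦ rfl)).congr_deriv ?_
      ring
    have hL0 : HasFDerivAt Ψ (fderiv ℝ Ψ (horizonPoint M σ θ φ)) (horizonPoint M σ θ φ) := (hd0 _).hasFDerivAt
    have h4 : HasDerivAt (fun θ' ↦ Ψ (horizonPoint M σ θ' φ))
        (fderiv ℝ Ψ (horizonPoint M σ θ φ) (thetaVec M θ φ)) θ :=
      hL0.comp_hasDerivAt θ (hasDerivAt_horizonPoint_theta M σ θ φ)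
    have h : HasDerivAt (fun θ' ↦ Real.sin θ' ^ 2 * thetaFlux M Ψ σ θ' φ -
        2 * Real.sin θ' ^ 2 * Real.cos θ' * Ψ (horizonPoint M σ θ' φ))
        (2 * Real.sin θ * Real.cos θ * thetaFlux M Ψ σ θ φ + Real.sin θ ^ 2 * (Real.cos θ *
          fderiv ℝ Ψ (horizonPoint M σ θ φ) (thetaVec M θ φ) + Real.sin θ *
            (fderiv ℝ (fderiv ℝ Ψ) (horizonPoint M σ θ φ) (thetaVec M θ φ) (thetaVec M θ φ) +
              fderiv ℝ Ψ (horizonPoint M σ θ φ) (dThetaVec M θ φ))) -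
          ((4 * Real.sin θ * Real.cos θ ^ 2 - 2 * Real.sin θ ^ 3) * Ψ (horizonPoint M σ θ φ) +
            2 * Real.sin θ ^ 2 * Real.cos θ * fderiv ℝ Ψ (horizonPoint M σ θ φ) (thetaVec M θ φ))) θ :=
      ((h1.fun_mul h2).fun_sub (h3.fun_mul h4)).congr_of_eventuallyEq (Eventually.of_forall fun θ' ↦ rfl)
    refine h.congr_deriv ?_
    simp only [thetaFlux, thetaFluxDeriv]
    ring
  · intro φ; simp
  · intro φ; simp
  · refine continuous_angles_of_clamp (K := fun σ θ φ ↦ Real.sin θ ^ 2 * phiFluxDeriv M Ψ σ θ φ) ?_ hσ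
    exact (by fun_prop : Continuous fun q : ℝ × ℝ × ℝ ↦ Real.sin q.2.1 ^ 2).mul hdEc
  · refine continuous_angles_of_clamp (K := fun σ θ φ ↦ Real.sin θ ^ 2 * thetaFluxDeriv M Ψ σ θ φ -
      (4 * Real.sin θ * Real.cos θ ^ 2 - 2 * Real.sin θ ^ 3) * Ψ (horizonPoint M σ θ φ)) ?_ hσ
    exact ((by fun_prop : Continuous fun q : ℝ × ℝ × ℝ ↦ Real.sin q.2.1 ^ 2).mul hdTc).sub
      ((by fun_prop : Continuous fun q : ℝ × ℝ × ℝ ↦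
        4 * Real.sin q.2.1 * Real.cos q.2.1 ^ 2 - 2 * Real.sin q.2.1 ^ 3).mul h0)
  · refine continuous_angles_of_clamp (K := fun σ θ φ ↦
      -((4 * Real.sin θ * Real.cos θ ^ 2 - 2 * Real.sin θ ^ 3) * Ψ (horizonPoint M σ θ φ))) ?_ hσ
    exact ((by fun_prop : Continuous fun q : ℝ × ℝ × ℝ ↦
        4 * Real.sin q.2.1 * Real.cos q.2.1 ^ 2 - 2 * Real.sin q.2.1 ^ 3).mul h0).neg

/-- **Evolution of the second-order integral**: for a smooth solution and `0 ≤ a ≤ b`,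
`G₂(b) = G₂(a) − 4M² ∫_a^b ∫∫ sin θ · YΨ(p_σ) dσ`, `G₂(σ) = ∫∫ D₂(σ)` (`secondDensity`): Aretakis's
`∫∫ V(f[ψ,Dψ,DDψ]) + ∫∫ Yψ = 0`. [cite: Aretakis2015, Thm. 2] -/
theorem secondIntegral_evolution (hM : 0 < M) (hr₀ : r₀ ∈ Set.Ioo 0 M) (hU₀ : IsOpen U₀)
    (hKU₀ : {x : Kerr.region M r₀ | Kerr.rPlus M M ≤ Kerr.radius M (x : E4) ∧ 0 ≤ (x : E4) 0} ⊆ U₀)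
    (hΨ : ContDiff ℝ ∞ Ψ)
    (hsol : ∀ x ∈ U₀, (Kerr.smoothMetric M M r₀).toPseudoRiemannianMetric.dalembertian
      (fun y : Kerr.region M r₀ ↦ Ψ y) x = 0) {a b : ℝ} (ha : 0 ≤ a) (hab : a ≤ b) :
    ∫ φ in (0 : ℝ)..2 * Real.pi, ∫ θ in (0 : ℝ)..Real.pi, secondDensity M Ψ b θ φ =
      (∫ φ in (0 : ℝ)..2 * Real.pi, ∫ θ in (0 : ℝ)..Real.pi, secondDensity M Ψ a θ φ) +
        ∫ σ in a..b, ∫ φ in (0 : ℝ)..2 * Real.pi, ∫ θ in (0 : ℝ)..Real.pi,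
          -(4 * M ^ 2) * (Real.sin θ * fderiv ℝ Ψ (horizonPoint M σ θ φ) (horizonNull θ φ)) := by
  obtain ⟨hr₀pos, hr₀M⟩ := hr₀
  have hmem : ∀ σ θ φ, 0 ≤ σ → ∃ hp : horizonPoint M σ θ φ ∈ Kerr.region M r₀,
      (⟨_, hp⟩ : Kerr.region M r₀) ∈ U₀ := by
    intro σ θ φ hσ
    refine ⟨horizonPoint_mem_region hM hr₀M σ θ φ, hKU₀ ⟨?_, ?_⟩⟩
    · show Kerr.rPlus M M ≤ Kerr.radius M (horizonPoint M σ θ φ)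
      rw [rPlus_self, radius_horizonPoint hM.le]
    · show 0 ≤ horizonPoint M σ θ φ 0
      rw [horizonPoint_apply_zero]; exact hσ
  obtain ⟨-, -, hY, -, -, -⟩ := continuous_clamp_terms (M := M) hΨ
  refine sphereIntegral_eq_add_source (D := fun σ θ φ ↦ secondDensity M Ψ σ θ φ)
    (E := fun σ θ φ ↦ secondPhiFlux M Ψ σ θ φ) (T := fun σ θ φ ↦ secondThetaFlux M Ψ σ θ φ)
    (dE := fun σ θ φ ↦ secondPhiFluxDeriv M Ψ σ θ φ) (dT := fun σ θ φ ↦ secondThetaFluxDeriv M Ψ σ θ φ)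
    (S := fun σ θ φ ↦ -(4 * M ^ 2) * (Real.sin θ * fderiv ℝ Ψ (horizonPoint M σ θ φ) (horizonNull θ φ)))
    (c := -(2 * M ^ 2)) ha hab ?_ ?_ ?_ ?_ ?_ ?_ ?_ ?_ ?_ ?_
  · intro σ θ φ hσ
    obtain ⟨hp, hpU⟩ := hmem σ θ φ hσ
    obtain ⟨hW₁, hW₂⟩ := waveCoord_and_fderiv_eq_zero hΨ hU₀ hsol ⟨_, hp⟩ hpU
      (Kerr.nullVector M (horizonPoint M σ θ φ))
    exact hasDerivAt_secondDensity_of_wave hM hΨ σ θ φ hW₁ hW₂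
  · intro σ θ φ _
    exact hasDerivAt_secondPhiFlux_phi hΨ σ θ φ
  · intro σ θ _
    have h := secondPhiFlux_add_two_pi M Ψ σ θ 0
    rw [zero_add] at h
    exact h
  · intro σ θ φ _
    exact hasDerivAt_secondThetaFlux_theta hΨ σ θ φ
  · intro σ φ; exact secondThetaFlux_zero M Ψ σ φ
  · intro σ φ; exact secondThetaFlux_pi M Ψ σ φ
  · exact continuous_secondPhiFluxDeriv_clamp hΨ
  · exact continuous_secondThetaFluxDeriv_clamp hΨ
  · exact continuous_const.mul ((by fun_prop : Continuous fun q : ℝ × ℝ × ℝ ↦ Real.sin q.2.1).mul hY)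
  · exact continuous_secondDensity_clamp hΨ

omit [Kerr.Facts] [Kerr.SliceFacts] in
/-- **Split of the second-order integral**:
`G₂(σ) = 8M⁴ ∫∫ sin θ YYΨ + 2M⁴ ∫∫ sin³ θ TYΨ + 12M³ ∫∫ sin θ YΨ + 4M² ∫∫ sin θ Ψ` on `S_σ`, `σ ≥ 0`.
[folklore] -/
theorem secondIntegral_split (hΨ : ContDiff ℝ ∞ Ψ) {σ : ℝ} (hσ : 0 ≤ σ) :
    ∫ φ in (0 : ℝ)..2 * Real.pi, ∫ θ in (0 : ℝ)..Real.pi, secondDensity M Ψ σ θ φ =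
      8 * M ^ 4 * (∫ φ in (0 : ℝ)..2 * Real.pi, ∫ θ in (0 : ℝ)..Real.pi,
        Real.sin θ * fderiv ℝ (fderiv ℝ Ψ) (horizonPoint M σ θ φ) (horizonNull θ φ) (horizonNull θ φ)) +
      2 * M ^ 4 * (∫ φ in (0 : ℝ)..2 * Real.pi, ∫ θ in (0 : ℝ)..Real.pi,
        Real.sin θ ^ 3 * fderiv ℝ (fderiv ℝ Ψ) (horizonPoint M σ θ φ) (E4.basisVector 0) (horizonNull θ φ)) +
      12 * M ^ 3 * (∫ φ in (0 : ℝ)..2 * Real.pi, ∫ θ in (0 : ℝ)..Real.pi,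
        Real.sin θ * fderiv ℝ Ψ (horizonPoint M σ θ φ) (horizonNull θ φ)) +
      4 * M ^ 2 * (∫ φ in (0 : ℝ)..2 * Real.pi, ∫ θ in (0 : ℝ)..Real.pi,
        Real.sin θ * Ψ (horizonPoint M σ θ φ)) := by
  obtain ⟨h0, -, hY, -, hTY, hYY⟩ := continuous_clamp_terms (M := M) hΨ
  have c1 := continuous_angles_of_clamp (K := fun σ θ φ ↦ 8 * M ^ 4 *
    (Real.sin θ * fderiv ℝ (fderiv ℝ Ψ) (horizonPoint M σ θ φ) (horizonNull θ φ) (horizonNull θ φ)))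
    (continuous_const.mul ((by fun_prop : Continuous fun q : ℝ × ℝ × ℝ ↦ Real.sin q.2.1).mul hYY)) hσ
  have c2 := continuous_angles_of_clamp (K := fun σ θ φ ↦ 2 * M ^ 4 *
    (Real.sin θ ^ 3 * fderiv ℝ (fderiv ℝ Ψ) (horizonPoint M σ θ φ) (E4.basisVector 0) (horizonNull θ φ)))
    (continuous_const.mul ((by fun_prop : Continuous fun q : ℝ × ℝ × ℝ ↦ Real.sin q.2.1 ^ 3).mul hTY)) hσ
  have c3 := continuous_angles_of_clamp (K := fun σ θ φ ↦ 12 * M ^ 3 *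
    (Real.sin θ * fderiv ℝ Ψ (horizonPoint M σ θ φ) (horizonNull θ φ)))
    (continuous_const.mul ((by fun_prop : Continuous fun q : ℝ × ℝ × ℝ ↦ Real.sin q.2.1).mul hY)) hσ
  have c4 := continuous_angles_of_clamp (K := fun σ θ φ ↦ 4 * M ^ 2 *
    (Real.sin θ * Ψ (horizonPoint M σ θ φ)))
    (continuous_const.mul ((by fun_prop : Continuous fun q : ℝ × ℝ × ℝ ↦ Real.sin q.2.1).mul h0)) hσ
  have c12 : Continuous (Function.uncurry fun θ φ ↦ 8 * M ^ 4 *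
      (Real.sin θ * fderiv ℝ (fderiv ℝ Ψ) (horizonPoint M σ θ φ) (horizonNull θ φ) (horizonNull θ φ)) +
      2 * M ^ 4 * (Real.sin θ ^ 3 * fderiv ℝ (fderiv ℝ Ψ) (horizonPoint M σ θ φ) (E4.basisVector 0)
        (horizonNull θ φ))) := by
    rw [Function.uncurry_def] at c1 c2 ⊢; exact c1.add c2
  have c123 : Continuous (Function.uncurry fun θ φ ↦ 8 * M ^ 4 *
      (Real.sin θ * fderiv ℝ (fderiv ℝ Ψ) (horizonPoint M σ θ φ) (horizonNull θ φ) (horizonNull θ φ)) +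
      2 * M ^ 4 * (Real.sin θ ^ 3 * fderiv ℝ (fderiv ℝ Ψ) (horizonPoint M σ θ φ) (E4.basisVector 0)
        (horizonNull θ φ)) +
      12 * M ^ 3 * (Real.sin θ * fderiv ℝ Ψ (horizonPoint M σ θ φ) (horizonNull θ φ))) := by
    rw [Function.uncurry_def] at c12 c3 ⊢; exact c12.add c3
  rw [← sphereIntegral_const_mul (8 * M ^ 4), ← sphereIntegral_const_mul (2 * M ^ 4),
    ← sphereIntegral_const_mul (12 * M ^ 3), ← sphereIntegral_const_mul (4 * M ^ 2),
    ← sphereIntegral_add c1 c2, ← sphereIntegral_add c12 c3, ← sphereIntegral_add c123 c4]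
  refine intervalIntegral.integral_congr fun φ _ ↦ intervalIntegral.integral_congr fun θ _ ↦ ?_
  simp only [secondDensity]
  ring

omit [Kerr.Facts] [Kerr.SliceFacts] in
/-- **Continuity in `σ` of the clamped sphere integral of `sin θ · YΨ`.** [folklore] -/
theorem continuous_transversalIntegral (hΨ : ContDiff ℝ ∞ Ψ) :
    Continuous fun σ ↦ ∫ φ in (0 : ℝ)..2 * Real.pi, ∫ θ in (0 : ℝ)..Real.pi,
      Real.sin θ * fderiv ℝ Ψ (horizonPoint M (max σ 0) θ φ) (horizonNull θ φ) := by
  have hP : Continuous fun r : (ℝ × ℝ) × ℝ ↦ horizonPoint M (max r.1.1 0) r.2 r.1.2 := by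
    simp only [horizonPoint_eq_toLp]
    refine continuous_toLp_four ?_ ?_ ?_ ?_ <;> fun_prop
  have hN : Continuous fun r : (ℝ × ℝ) × ℝ ↦ horizonNull r.2 r.1.2 := by
    simp only [horizonNull]
    refine continuous_toLp_four ?_ ?_ ?_ ?_ <;> fun_prop
  have hL : Continuous fun r : (ℝ × ℝ) × ℝ ↦ fderiv ℝ Ψ (horizonPoint M (max r.1.1 0) r.2 r.1.2) :=
    (hΨ.continuous_fderiv (WithTop.coe_ne_zero.mpr ENat.top_ne_zero)).comp hP
  have h1 : Continuous (Function.uncurry fun (q : ℝ × ℝ) θ ↦ Real.sin θ *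
      fderiv ℝ Ψ (horizonPoint M (max q.1 0) θ q.2) (horizonNull θ q.2)) := by
    rw [Function.uncurry_def]
    exact (by fun_prop : Continuous fun r : (ℝ × ℝ) × ℝ ↦ Real.sin r.2).mul (hL.clm_apply hN)
  have h2 : Continuous fun q : ℝ × ℝ ↦ ∫ θ in (0 : ℝ)..Real.pi, Real.sin θ *
      fderiv ℝ Ψ (horizonPoint M (max q.1 0) θ q.2) (horizonNull θ q.2) :=
    intervalIntegral.continuous_parametric_intervalIntegral_of_continuous' h1 0 Real.pi
  have h3 : Continuous (Function.uncurry fun σ φ ↦ ∫ θ in (0 : ℝ)..Real.pi, Real.sin θ *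
      fderiv ℝ Ψ (horizonPoint M (max σ 0) θ φ) (horizonNull θ φ)) := by
    rw [Function.uncurry_def]; exact h2
  exact intervalIntegral.continuous_parametric_intervalIntegral_of_continuous' h3 0 (2 * Real.pi)

end SolutionIdentities

/-! ### Elementary estimates -/

/-- `|4 cos² θ − 2 sin² θ| ≤ 6`. [folklore] -/
theorem abs_four_cos_sq_sub_le (θ : ℝ) : |4 * Real.cos θ ^ 2 - 2 * Real.sin θ ^ 2| ≤ 6 := by
  have hc : Real.cos θ ^ 2 ≤ 1 := Real.cos_sq_le_one θ
  have hs : Real.sin θ ^ 2 ≤ 1 := Real.sin_sq_le_one θ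
  have hc0 : 0 ≤ Real.cos θ ^ 2 := sq_nonneg _
  have hs0 : 0 ≤ Real.sin θ ^ 2 := sq_nonneg _
  rw [abs_le]; constructor <;> nlinarith

/-- On `[0, π]`: `0 ≤ sin θ`, `sin³ θ ≤ sin θ`. [folklore] -/
theorem sin_pow_three_le {θ : ℝ} (hθ : θ ∈ Icc (0 : ℝ) Real.pi) :
    0 ≤ Real.sin θ ∧ Real.sin θ ^ 3 ≤ Real.sin θ := by
  have hs : 0 ≤ Real.sin θ := Real.sin_nonneg_of_nonneg_of_le_pi hθ.1 hθ.2
  have hs1 : Real.sin θ ^ 2 ≤ 1 := Real.sin_sq_le_one θ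
  refine ⟨hs, ?_⟩
  nlinarith

/-- A lower bound for `|G|` from `|G − G₀ + c| ≤ e`: `|c| − |G₀| − e ≤ |G|`. [folklore] -/
theorem abs_ge_of_abs_sub_add_le {G G₀ c e : ℝ} (h : |G - G₀ + c| ≤ e) : |c| - |G₀| - e ≤ |G| := by
  have h1 : |c| ≤ |G - G₀ + c| + |G - G₀| := by
    have := abs_add_le (G - G₀ + c) (-(G - G₀))
    rwa [show G - G₀ + c + -(G - G₀) = c by ring, abs_neg] at this
  have h2 : |G - G₀| ≤ |G| + |G₀| := abs_sub _ _
  linarith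

/-! ### The core estimate: linear growth of `sup_{S_τ} |YYΨ|` for a smooth axisymmetric solution -/

/-- **The blow-up mechanism on extremal Kerr (core estimate).** Let `Ψ` be smooth on `E4`,
axisymmetric, localised on the leaf together with `DΨ`, and solve `□_{g_{M,M}} = 0` as a chart function
on an open set `U₀ ⊇ {r ≥ M} ∩ {t* ≥ 0}` of the extremal Kerr–Schild chart, with Aretakis charge
`H₀ ≠ 0`. Assume the decay fact `Aretakis2012_pointwiseDecay`. Then there is `τ₁ ≥ 0` such that for
every `τ ≥ τ₁` some point `p_τ(θ, φ)` of the horizon sphere `S_τ` has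
`|D²Ψ(p)(ℓ♯, ℓ♯)| ≥ |H₀| τ / (256 π M⁵)`.
Proof (Aretakis 2015, Thm. 2, made quantitative with the decay of `Ψ, TΨ, TTΨ` from Aretakis 2012,
Thm. 5): with `G₂(σ) = ∫∫ D₂(σ)`, `I(σ) = ∫∫ sin θ YΨ`, one has `G₂' = −4M² I`
(`secondIntegral_evolution`), `8M³ I → H₀` (conservation, `charge_split`), the `sin² θ`-weighted wave
equation on the horizon controls `∫∫ sin³ θ TYΨ` by `Ψ, TΨ, TTΨ` (`static_identity`), and
`G₂ = 8M⁴ ∫∫ sin θ YYΨ + 2M⁴ ∫∫ sin³ θ TYΨ + 12M³ I + 4M² ∫∫ sin θ Ψ` (`secondIntegral_split`); hence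
`|8M⁴ ∫∫ sin θ YYΨ| ≥ (3|H₀|/8M)(τ − τ₀) − const`, while `|∫∫ sin θ YYΨ| ≤ 4π sup_{S_τ}|YYΨ|`.
[cite: Aretakis2015, Thm. 2 and Thm. 3 (k = 2); Aretakis2012, Thm. 5] -/
theorem secondDeriv_blowup_core (hDec : Aretakis2012_pointwiseDecay) [Kerr.Facts] [Kerr.SliceFacts]
    {M : ℝ} (hM : 0 < M) {r₀ : ℝ} (hr₀ : r₀ ∈ Set.Ioo 0 M) {U₀ : Set (Kerr.region M r₀)} (hU₀ : IsOpen U₀)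
    (hKU₀ : {x : Kerr.region M r₀ | Kerr.rPlus M M ≤ Kerr.radius M (x : E4) ∧ 0 ≤ (x : E4) 0} ⊆ U₀)
    {Ψ : E4 → ℝ} (hΨ : ContDiff ℝ ∞ Ψ)
    (hsol : ∀ x ∈ U₀, (Kerr.smoothMetric M M r₀).toPseudoRiemannianMetric.dalembertian
      (fun y : Kerr.region M r₀ ↦ Ψ y) x = 0)
    {ρ : ℝ} (hloc : ∀ x ∈ U₀, (x : E4) 0 = 0 → ρ < E4.spatialNorm (x : E4) → Ψ x = 0 ∧ fderiv ℝ Ψ x = 0)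
    (haxi : ∀ β x, Ψ (E4.axialRotation β x) = Ψ x)
    (hH : aretakisCharge M r₀ (fun y : Kerr.region M r₀ ↦ Ψ y) ≠ 0) :
    ∃ τ₁ : ℝ, 0 ≤ τ₁ ∧ ∀ τ : ℝ, τ₁ ≤ τ → ∃ θ φ : ℝ,
      1 / (256 * Real.pi * M ^ 5) * |aretakisCharge M r₀ (fun y : Kerr.region M r₀ ↦ Ψ y)| * τ ≤
        |fderiv ℝ (fderiv ℝ Ψ) (horizonPoint M τ θ φ) (horizonNull θ φ) (horizonNull θ φ)| := by
  have hπ := Real.pi_pos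
  have hM0 : M ≠ 0 := hM.ne'
  obtain ⟨H, hHdef⟩ : ∃ H : ℝ, aretakisCharge M r₀ (fun y : Kerr.region M r₀ ↦ Ψ y) = H := ⟨_, rfl⟩
  rw [hHdef] at hH ⊢
  obtain ⟨A, hAdef⟩ : ∃ A : ℝ, |H| = A := ⟨_, rfl⟩
  rw [hAdef]
  have hA : 0 < A := by rw [← hAdef]; exact abs_pos.mpr hH
  have hA0 : A ≠ 0 := hA.ne'
  obtain ⟨ε, hεdef⟩ : ∃ ε : ℝ, A / (32 * Real.pi * M ^ 2 * (M + 2)) = ε := ⟨_, rfl⟩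
  have hε : 0 < ε := by rw [← hεdef]; positivity
  have hd1 : Differentiable ℝ (fderiv ℝ Ψ) :=
    (hΨ.fderiv_right (m := ∞) le_rfl).differentiable (WithTop.coe_ne_zero.mpr ENat.top_ne_zero)
  /- Step 1: the class is closed under `T`; decay of `Ψ, TΨ, TTΨ` on the horizon spheres -/
  obtain ⟨hTΨ, hsolT, hlocT, haxiT⟩ := timeDeriv_in_class hM.le hΨ hU₀ hsol hloc haxi
  obtain ⟨hTTΨ, hsolTT, hlocTT, haxiTT⟩ := timeDeriv_in_class hM.le hTΨ hU₀ hsolT hlocT haxiT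
  obtain ⟨τa, ha⟩ := decay_at_horizonPoint hDec hM hr₀ hU₀ hKU₀ hΨ hsol hloc haxi hε
  obtain ⟨τb, hb⟩ := decay_at_horizonPoint hDec hM hr₀ hU₀ hKU₀ hTΨ hsolT hlocT haxiT hε
  obtain ⟨τc, hc⟩ := decay_at_horizonPoint hDec hM hr₀ hU₀ hKU₀ hTTΨ hsolTT hlocTT haxiTT hε
  obtain ⟨τ₀, hτ₀def⟩ : ∃ τ₀ : ℝ, max (max τa τb) (max τc 0) = τ₀ := ⟨_, rfl⟩
  have hτ₀ : 0 ≤ τ₀ := by rw [← hτ₀def]; exact le_trans (le_max_right _ _) (le_max_right _ _)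
  have hbd : ∀ σ, τ₀ ≤ σ → ∀ θ φ, |Ψ (horizonPoint M σ θ φ)| ≤ ε ∧
      |fderiv ℝ Ψ (horizonPoint M σ θ φ) (E4.basisVector 0)| ≤ ε ∧
      |fderiv ℝ (fderiv ℝ Ψ) (horizonPoint M σ θ φ) (E4.basisVector 0) (E4.basisVector 0)| ≤ ε := by
    intro σ hσ θ φ
    rw [← hτ₀def] at hσ
    have hσa : τa ≤ σ := le_trans (le_trans (le_max_left _ _) (le_max_left _ _)) hσ
    have hσb : τb ≤ σ := le_trans (le_trans (le_max_right _ _) (le_max_left _ _)) hσ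
    have hσc : τc ≤ σ := le_trans (le_trans (le_max_left _ _) (le_max_right _ _)) hσ
    refine ⟨ha σ hσa θ φ, hb σ hσb θ φ, ?_⟩
    have h := hc σ hσc θ φ
    beta_reduce at h
    rwa [fderiv_clm_apply_const_apply (hd1 _)] at h
  /- Step 2: the clamped transversal integral `Ic(σ) = ∫∫ sin θ · YΨ(p_{max(σ,0)})` and `G(σ) = ∫∫ D₂(σ)` -/
  obtain ⟨Ic, hIcdef⟩ : ∃ Ic : ℝ → ℝ, (fun σ ↦ ∫ φ in (0 : ℝ)..2 * Real.pi, ∫ θ in (0 : ℝ)..Real.pi,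
    Real.sin θ * fderiv ℝ Ψ (horizonPoint M (max σ 0) θ φ) (horizonNull θ φ)) = Ic := ⟨_, rfl⟩
  have hIc : Continuous Ic := by rw [← hIcdef]; exact continuous_transversalIntegral hΨ
  have hIcraw : ∀ σ, 0 ≤ σ → Ic σ = ∫ φ in (0 : ℝ)..2 * Real.pi, ∫ θ in (0 : ℝ)..Real.pi,
      Real.sin θ * fderiv ℝ Ψ (horizonPoint M σ θ φ) (horizonNull θ φ) := by
    intro σ hσ
    rw [← hIcdef]
    simp only [max_eq_left hσ]
  obtain ⟨G, hGdef⟩ : ∃ G : ℝ → ℝ, (fun σ ↦ ∫ φ in (0 : ℝ)..2 * Real.pi, ∫ θ in (0 : ℝ)..Real.pi,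
    secondDensity M Ψ σ θ φ) = G := ⟨_, rfl⟩
  have hGapp : ∀ σ, G σ = ∫ φ in (0 : ℝ)..2 * Real.pi, ∫ θ in (0 : ℝ)..Real.pi, secondDensity M Ψ σ θ φ :=
    fun σ ↦ by rw [← hGdef]
  /- Step 3 (E1): `|8M³ ∫∫ sin θ YΨ − H| ≤ A/4` on `S_σ`, `σ ≥ τ₀` -/
  have hE1 : ∀ σ, τ₀ ≤ σ → |8 * M ^ 3 * (∫ φ in (0 : ℝ)..2 * Real.pi, ∫ θ in (0 : ℝ)..Real.pi,
      Real.sin θ * fderiv ℝ Ψ (horizonPoint M σ θ φ) (horizonNull θ φ)) - H| ≤ A / 4 := by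
    intro σ hσ
    have hσ0 : 0 ≤ σ := hτ₀.trans hσ
    have hsplit := charge_split hM hr₀ hU₀ hKU₀ hΨ hsol hσ0
    rw [hHdef] at hsplit
    have hbound : ∀ θ ∈ Icc (0 : ℝ) Real.pi, ∀ φ ∈ Icc (0 : ℝ) (2 * Real.pi),
        |2 * M ^ 2 * Real.sin θ * (M * Real.sin θ ^ 2 * fderiv ℝ Ψ (horizonPoint M σ θ φ) (E4.basisVector 0) +
          2 * Ψ (horizonPoint M σ θ φ))| ≤ (2 * M ^ 2 * ((M + 2) * ε)) * Real.sin θ := by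
      intro θ hθ φ _
      obtain ⟨hs, -⟩ := sin_pow_three_le hθ
      have hs1 : Real.sin θ ^ 2 ≤ 1 := Real.sin_sq_le_one θ
      obtain ⟨h0, hT, -⟩ := hbd σ hσ θ φ
      have h1 : |M * Real.sin θ ^ 2 * fderiv ℝ Ψ (horizonPoint M σ θ φ) (E4.basisVector 0)| ≤ M * ε := by
        rw [abs_mul, abs_mul, abs_of_pos hM, abs_of_nonneg (sq_nonneg _)]
        calc M * Real.sin θ ^ 2 * |fderiv ℝ Ψ (horizonPoint M σ θ φ) (E4.basisVector 0)| ≤ M * 1 * ε := by gcongr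
          _ = M * ε := by ring
      have h2 : |2 * Ψ (horizonPoint M σ θ φ)| ≤ 2 * ε := by rw [abs_mul, abs_two]; linarith
      have h3 : |M * Real.sin θ ^ 2 * fderiv ℝ Ψ (horizonPoint M σ θ φ) (E4.basisVector 0) +
          2 * Ψ (horizonPoint M σ θ φ)| ≤ (M + 2) * ε := by
        have := abs_add_le (M * Real.sin θ ^ 2 * fderiv ℝ Ψ (horizonPoint M σ θ φ) (E4.basisVector 0))
          (2 * Ψ (horizonPoint M σ θ φ))
        linarith
      rw [abs_mul, abs_of_nonneg (by positivity : (0 : ℝ) ≤ 2 * M ^ 2 * Real.sin θ)]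
      calc 2 * M ^ 2 * Real.sin θ * |M * Real.sin θ ^ 2 * fderiv ℝ Ψ (horizonPoint M σ θ φ) (E4.basisVector 0) +
            2 * Ψ (horizonPoint M σ θ φ)|
          ≤ 2 * M ^ 2 * Real.sin θ * ((M + 2) * ε) := by gcongr
        _ = (2 * M ^ 2 * ((M + 2) * ε)) * Real.sin θ := by ring
    have hR := abs_sphereIntegral_le hbound
    have hval : 4 * Real.pi * (2 * M ^ 2 * ((M + 2) * ε)) = A / 4 := by
      rw [← hεdef]; field_simp; ring
    rw [hval] at hR
    have heq : 8 * M ^ 3 * (∫ φ in (0 : ℝ)..2 * Real.pi, ∫ θ in (0 : ℝ)..Real.pi,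
        Real.sin θ * fderiv ℝ Ψ (horizonPoint M σ θ φ) (horizonNull θ φ)) - H =
        -(∫ φ in (0 : ℝ)..2 * Real.pi, ∫ θ in (0 : ℝ)..Real.pi,
          2 * M ^ 2 * Real.sin θ * (M * Real.sin θ ^ 2 * fderiv ℝ Ψ (horizonPoint M σ θ φ) (E4.basisVector 0) +
            2 * Ψ (horizonPoint M σ θ φ))) := by
      rw [hsplit]; ring
    rw [heq, abs_neg]
    exact hR
  /- Step 4 (E2): evolution `|G(τ) − G(τ₀) + (H/2M)(τ − τ₀)| ≤ (A/8M)(τ − τ₀)` for `τ ≥ τ₀` -/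
  have hE2 : ∀ τ, τ₀ ≤ τ → |G τ - G τ₀ + H / (2 * M) * (τ - τ₀)| ≤ A / (8 * M) * (τ - τ₀) := by
    intro τ hτ
    have hev := secondIntegral_evolution hM hr₀ hU₀ hKU₀ hΨ hsol hτ₀ hτ
    -- the source integral in terms of `Ic`
    have hsrc : ∫ σ in τ₀..τ, ∫ φ in (0 : ℝ)..2 * Real.pi, ∫ θ in (0 : ℝ)..Real.pi,
        -(4 * M ^ 2) * (Real.sin θ * fderiv ℝ Ψ (horizonPoint M σ θ φ) (horizonNull θ φ)) =
        -(4 * M ^ 2) * ∫ σ in τ₀..τ, Ic σ := by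
      rw [← intervalIntegral.integral_const_mul]
      refine intervalIntegral.integral_congr fun σ hσ ↦ ?_
      rw [uIcc_of_le hτ] at hσ
      rw [hIcraw σ (hτ₀.trans hσ.1), sphereIntegral_const_mul]
    have hG : G τ - G τ₀ = -(4 * M ^ 2) * ∫ σ in τ₀..τ, Ic σ := by
      rw [hGapp, hGapp, hev, hsrc]; ring
    -- `|∫ Ic − (H/8M³)(τ − τ₀)| ≤ (A/32M³)(τ − τ₀)`
    have hi1 : IntervalIntegrable Ic volume τ₀ τ := hIc.intervalIntegrable _ _
    have hi2 : IntervalIntegrable (fun _ ↦ H / (8 * M ^ 3)) volume τ₀ τ := intervalIntegrable_const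
    have hdiff : (∫ σ in τ₀..τ, Ic σ) - H / (8 * M ^ 3) * (τ - τ₀) = ∫ σ in τ₀..τ, (Ic σ - H / (8 * M ^ 3)) := by
      rw [intervalIntegral.integral_sub hi1 hi2, intervalIntegral.integral_const, smul_eq_mul]; ring
    have hM3 : 0 < 8 * M ^ 3 := by positivity
    have hpt : ∀ σ ∈ Set.uIoc τ₀ τ, ‖Ic σ - H / (8 * M ^ 3)‖ ≤ A / (32 * M ^ 3) := by
      intro σ hσ
      rw [uIoc_of_le hτ] at hσ
      have hσ' : τ₀ ≤ σ := hσ.1.le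
      rw [Real.norm_eq_abs, hIcraw σ (hτ₀.trans hσ')]
      have h := hE1 σ hσ'
      obtain ⟨X, hXdef⟩ : ∃ X : ℝ, (∫ φ in (0 : ℝ)..2 * Real.pi, ∫ θ in (0 : ℝ)..Real.pi,
        Real.sin θ * fderiv ℝ Ψ (horizonPoint M σ θ φ) (horizonNull θ φ)) = X := ⟨_, rfl⟩
      rw [hXdef] at h ⊢
      have e1 : 8 * M ^ 3 * (X - H / (8 * M ^ 3)) = 8 * M ^ 3 * X - H := by
        rw [mul_sub, mul_div_cancel₀ H hM3.ne']
      have e2 : |X - H / (8 * M ^ 3)| = |8 * M ^ 3 * X - H| / (8 * M ^ 3) := by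
        rw [← e1, abs_mul, abs_of_pos hM3, mul_div_cancel_left₀ _ hM3.ne']
      rw [e2, div_le_iff₀ hM3]
      calc |8 * M ^ 3 * X - H| ≤ A / 4 := h
        _ = A / (32 * M ^ 3) * (8 * M ^ 3) := by field_simp; ring
    have hint := intervalIntegral.norm_integral_le_of_norm_le_const hpt
    rw [Real.norm_eq_abs, abs_of_nonneg (sub_nonneg.mpr hτ), ← hdiff] at hint
    have hkey : G τ - G τ₀ + H / (2 * M) * (τ - τ₀) =
        -(4 * M ^ 2) * ((∫ σ in τ₀..τ, Ic σ) - H / (8 * M ^ 3) * (τ - τ₀)) := by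
      rw [hG]; field_simp; ring
    rw [hkey, abs_mul, abs_neg, abs_of_pos (by positivity : (0 : ℝ) < 4 * M ^ 2)]
    calc 4 * M ^ 2 * |(∫ σ in τ₀..τ, Ic σ) - H / (8 * M ^ 3) * (τ - τ₀)|
        ≤ 4 * M ^ 2 * (A / (32 * M ^ 3) * (τ - τ₀)) := by gcongr
      _ = A / (8 * M) * (τ - τ₀) := by field_simp; ring
  /- Step 5 (E3): `|∫∫ 4M² sin³ θ TYΨ| ≤ 4π (6 + M(M+2)) ε` on `S_σ`, `σ ≥ τ₀` -/
  have hE3 : ∀ σ, τ₀ ≤ σ → |∫ φ in (0 : ℝ)..2 * Real.pi, ∫ θ in (0 : ℝ)..Real.pi,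
      4 * M ^ 2 * Real.sin θ ^ 3 *
        fderiv ℝ (fderiv ℝ Ψ) (horizonPoint M σ θ φ) (E4.basisVector 0) (horizonNull θ φ)| ≤
      4 * Real.pi * (6 * ε) + 4 * Real.pi * (M * (M + 2) * ε) := by
    intro σ hσ
    have hσ0 : 0 ≤ σ := hτ₀.trans hσ
    have hstat := static_identity hM hr₀ hU₀ hKU₀ hΨ hsol hσ0
    obtain ⟨-, hTc, -, hTTc, hTYc, -⟩ := continuous_clamp_terms (M := M) hΨ
    have c1 := continuous_angles_of_clamp (K := fun σ θ φ ↦ 4 * M ^ 2 * Real.sin θ ^ 3 *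
        fderiv ℝ (fderiv ℝ Ψ) (horizonPoint M σ θ φ) (E4.basisVector 0) (horizonNull θ φ))
      ((by fun_prop : Continuous fun q : ℝ × ℝ × ℝ ↦ 4 * M ^ 2 * Real.sin q.2.1 ^ 3).mul hTYc) hσ0
    have c2 := continuous_angles_of_clamp (K := fun σ θ φ ↦ M * Real.sin θ ^ 3 * (M * Real.sin θ ^ 2 *
        fderiv ℝ (fderiv ℝ Ψ) (horizonPoint M σ θ φ) (E4.basisVector 0) (E4.basisVector 0) +
          2 * fderiv ℝ Ψ (horizonPoint M σ θ φ) (E4.basisVector 0)))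
      ((by fun_prop : Continuous fun q : ℝ × ℝ × ℝ ↦ M * Real.sin q.2.1 ^ 3).mul
        (((by fun_prop : Continuous fun q : ℝ × ℝ × ℝ ↦ M * Real.sin q.2.1 ^ 2).mul hTTc).add
          (continuous_const.mul hTc))) hσ0
    rw [sphereIntegral_add c1 c2] at hstat
    beta_reduce at hstat
    -- the three integrals as named reals
    obtain ⟨X₁, hX₁⟩ : ∃ X : ℝ, (∫ φ in (0 : ℝ)..2 * Real.pi, ∫ θ in (0 : ℝ)..Real.pi,
        4 * M ^ 2 * Real.sin θ ^ 3 *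
          fderiv ℝ (fderiv ℝ Ψ) (horizonPoint M σ θ φ) (E4.basisVector 0) (horizonNull θ φ)) = X := ⟨_, rfl⟩
    obtain ⟨X₂, hX₂⟩ : ∃ X : ℝ, (∫ φ in (0 : ℝ)..2 * Real.pi, ∫ θ in (0 : ℝ)..Real.pi,
        M * Real.sin θ ^ 3 * (M * Real.sin θ ^ 2 *
          fderiv ℝ (fderiv ℝ Ψ) (horizonPoint M σ θ φ) (E4.basisVector 0) (E4.basisVector 0) +
            2 * fderiv ℝ Ψ (horizonPoint M σ θ φ) (E4.basisVector 0))) = X := ⟨_, rfl⟩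
    obtain ⟨X₃, hX₃⟩ : ∃ X : ℝ, (∫ φ in (0 : ℝ)..2 * Real.pi, ∫ θ in (0 : ℝ)..Real.pi,
        -((4 * Real.sin θ * Real.cos θ ^ 2 - 2 * Real.sin θ ^ 3) * Ψ (horizonPoint M σ θ φ))) = X := ⟨_, rfl⟩
    -- bounds for the two other integrals
    have hb1 : ∀ θ ∈ Icc (0 : ℝ) Real.pi, ∀ φ ∈ Icc (0 : ℝ) (2 * Real.pi),
        |-((4 * Real.sin θ * Real.cos θ ^ 2 - 2 * Real.sin θ ^ 3) * Ψ (horizonPoint M σ θ φ))| ≤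
          (6 * ε) * Real.sin θ := by
      intro θ hθ φ _
      obtain ⟨hs, -⟩ := sin_pow_three_le hθ
      obtain ⟨h0, -, -⟩ := hbd σ hσ θ φ
      have h6 := abs_four_cos_sq_sub_le θ
      rw [abs_neg, abs_mul, show 4 * Real.sin θ * Real.cos θ ^ 2 - 2 * Real.sin θ ^ 3 =
        Real.sin θ * (4 * Real.cos θ ^ 2 - 2 * Real.sin θ ^ 2) by ring, abs_mul, abs_of_nonneg hs]
      calc Real.sin θ * |4 * Real.cos θ ^ 2 - 2 * Real.sin θ ^ 2| * |Ψ (horizonPoint M σ θ φ)|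
          ≤ Real.sin θ * 6 * ε := by gcongr
        _ = (6 * ε) * Real.sin θ := by ring
    have hb2 : ∀ θ ∈ Icc (0 : ℝ) Real.pi, ∀ φ ∈ Icc (0 : ℝ) (2 * Real.pi),
        |M * Real.sin θ ^ 3 * (M * Real.sin θ ^ 2 *
          fderiv ℝ (fderiv ℝ Ψ) (horizonPoint M σ θ φ) (E4.basisVector 0) (E4.basisVector 0) +
            2 * fderiv ℝ Ψ (horizonPoint M σ θ φ) (E4.basisVector 0))| ≤ (M * (M + 2) * ε) * Real.sin θ := by
      intro θ hθ φ _
      obtain ⟨hs, hs3⟩ := sin_pow_three_le hθ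
      have hs1 : Real.sin θ ^ 2 ≤ 1 := Real.sin_sq_le_one θ
      obtain ⟨-, hT, hTT⟩ := hbd σ hσ θ φ
      have h1 : |M * Real.sin θ ^ 2 *
          fderiv ℝ (fderiv ℝ Ψ) (horizonPoint M σ θ φ) (E4.basisVector 0) (E4.basisVector 0)| ≤ M * ε := by
        rw [abs_mul, abs_mul, abs_of_pos hM, abs_of_nonneg (sq_nonneg _)]
        calc M * Real.sin θ ^ 2 *
            |fderiv ℝ (fderiv ℝ Ψ) (horizonPoint M σ θ φ) (E4.basisVector 0) (E4.basisVector 0)|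
            ≤ M * 1 * ε := by gcongr
          _ = M * ε := by ring
      have h2 : |2 * fderiv ℝ Ψ (horizonPoint M σ θ φ) (E4.basisVector 0)| ≤ 2 * ε := by
        rw [abs_mul, abs_two]; linarith
      have h3 : |M * Real.sin θ ^ 2 *
          fderiv ℝ (fderiv ℝ Ψ) (horizonPoint M σ θ φ) (E4.basisVector 0) (E4.basisVector 0) +
            2 * fderiv ℝ Ψ (horizonPoint M σ θ φ) (E4.basisVector 0)| ≤ (M + 2) * ε := by
        have := abs_add_le (M * Real.sin θ ^ 2 *
          fderiv ℝ (fderiv ℝ Ψ) (horizonPoint M σ θ φ) (E4.basisVector 0) (E4.basisVector 0))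
          (2 * fderiv ℝ Ψ (horizonPoint M σ θ φ) (E4.basisVector 0))
        linarith
      have hs3' : 0 ≤ Real.sin θ ^ 3 := by positivity
      rw [abs_mul, abs_mul, abs_of_pos hM, abs_of_nonneg hs3']
      calc M * Real.sin θ ^ 3 * |M * Real.sin θ ^ 2 *
            fderiv ℝ (fderiv ℝ Ψ) (horizonPoint M σ θ φ) (E4.basisVector 0) (E4.basisVector 0) +
              2 * fderiv ℝ Ψ (horizonPoint M σ θ φ) (E4.basisVector 0)|
          ≤ M * Real.sin θ * ((M + 2) * ε) := by gcongr
        _ = (M * (M + 2) * ε) * Real.sin θ := by ring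
    have hI1 := abs_sphereIntegral_le hb1
    have hI2 := abs_sphereIntegral_le hb2
    rw [hX₃] at hI1
    rw [hX₂] at hI2
    rw [hX₁, hX₂, hX₃] at hstat
    rw [hX₁]
    have heq : X₁ = X₃ - X₂ := by rw [← hstat]; ring
    rw [heq]
    have := abs_sub X₃ X₂
    linarith
  /- Step 6: the constant and `τ₁` -/
  obtain ⟨K, hKdef⟩ : ∃ K : ℝ, M ^ 2 / 2 * (4 * Real.pi * (6 * ε) + 4 * Real.pi * (M * (M + 2) * ε)) +
      3 / 2 * (A + A / 4) + 4 * M ^ 2 * (4 * Real.pi * ε) = K := ⟨_, rfl⟩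
  have hK : 0 ≤ K := by rw [← hKdef]; positivity
  have hGK : 0 ≤ |G τ₀| + K := add_nonneg (abs_nonneg _) hK
  obtain ⟨τ₁, hτ₁def⟩ : ∃ τ₁ : ℝ, 3 / 2 * τ₀ + 4 * M / A * (|G τ₀| + K) = τ₁ := ⟨_, rfl⟩
  have hτ₁0 : τ₀ ≤ τ₁ := by
    have : 0 ≤ 4 * M / A * (|G τ₀| + K) := mul_nonneg (by positivity) hGK
    rw [← hτ₁def]; linarith
  refine ⟨τ₁, hτ₀.trans hτ₁0, fun τ hτ ↦ ?_⟩
  have hτ' : τ₀ ≤ τ := hτ₁0.trans hτ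
  have hτ0 : 0 ≤ τ := hτ₀.trans hτ'
  have hE1τ := hE1 τ hτ'
  have hE3τ := hE3 τ hτ'
  have hsplitG := secondIntegral_split (M := M) hΨ hτ0
  /- Step 7: the maximum `m` of `|YYΨ|` over the sphere `S_τ` -/
  obtain ⟨-, -, -, -, -, hYYc⟩ := continuous_clamp_terms (M := M) hΨ
  have hcY : Continuous fun q : ℝ × ℝ ↦ |fderiv ℝ (fderiv ℝ Ψ) (horizonPoint M τ q.1 q.2)
      (horizonNull q.1 q.2) (horizonNull q.1 q.2)| := by
    have h := continuous_angles_of_clamp (K := fun σ θ φ ↦ fderiv ℝ (fderiv ℝ Ψ) (horizonPoint M σ θ φ)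
      (horizonNull θ φ) (horizonNull θ φ)) hYYc hτ0
    rw [Function.uncurry_def] at h
    exact h.abs
  obtain ⟨q₀, hq₀, hmax⟩ := ((isCompact_Icc (a := (0 : ℝ)) (b := Real.pi)).prod
    (isCompact_Icc (a := (0 : ℝ)) (b := 2 * Real.pi))).exists_isMaxOn
    ((nonempty_Icc.mpr hπ.le).prod (nonempty_Icc.mpr (by positivity))) hcY.continuousOn
  refine ⟨q₀.1, q₀.2, ?_⟩
  obtain ⟨m, hmdef⟩ : ∃ m : ℝ, |fderiv ℝ (fderiv ℝ Ψ) (horizonPoint M τ q₀.1 q₀.2) (horizonNull q₀.1 q₀.2)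
    (horizonNull q₀.1 q₀.2)| = m := ⟨_, rfl⟩
  rw [hmdef]
  have hm0 : 0 ≤ m := by rw [← hmdef]; exact abs_nonneg _
  /- Step 8: the pieces of `G(τ)` as named reals, and their bounds -/
  obtain ⟨J, hJdef⟩ : ∃ J : ℝ, (∫ φ in (0 : ℝ)..2 * Real.pi, ∫ θ in (0 : ℝ)..Real.pi,
    Real.sin θ * fderiv ℝ (fderiv ℝ Ψ) (horizonPoint M τ θ φ) (horizonNull θ φ) (horizonNull θ φ)) = J := ⟨_, rfl⟩
  obtain ⟨P, hPdef⟩ : ∃ P : ℝ, (∫ φ in (0 : ℝ)..2 * Real.pi, ∫ θ in (0 : ℝ)..Real.pi,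
    Real.sin θ ^ 3 * fderiv ℝ (fderiv ℝ Ψ) (horizonPoint M τ θ φ) (E4.basisVector 0) (horizonNull θ φ)) = P :=
    ⟨_, rfl⟩
  obtain ⟨Iτ, hIτdef⟩ : ∃ I : ℝ, (∫ φ in (0 : ℝ)..2 * Real.pi, ∫ θ in (0 : ℝ)..Real.pi,
    Real.sin θ * fderiv ℝ Ψ (horizonPoint M τ θ φ) (horizonNull θ φ)) = I := ⟨_, rfl⟩
  obtain ⟨Q, hQdef⟩ : ∃ Q : ℝ, (∫ φ in (0 : ℝ)..2 * Real.pi, ∫ θ in (0 : ℝ)..Real.pi,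
    Real.sin θ * Ψ (horizonPoint M τ θ φ)) = Q := ⟨_, rfl⟩
  have hP4 : (∫ φ in (0 : ℝ)..2 * Real.pi, ∫ θ in (0 : ℝ)..Real.pi, 4 * M ^ 2 * Real.sin θ ^ 3 *
      fderiv ℝ (fderiv ℝ Ψ) (horizonPoint M τ θ φ) (E4.basisVector 0) (horizonNull θ φ)) = 4 * M ^ 2 * P := by
    rw [← hPdef, ← sphereIntegral_const_mul]
    exact intervalIntegral.integral_congr fun φ _ ↦ intervalIntegral.integral_congr fun θ _ ↦ by ring
  rw [hJdef, hPdef, hIτdef, hQdef] at hsplitG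
  rw [hIτdef] at hE1τ
  rw [hP4] at hE3τ
  have hGτ : G τ = 8 * M ^ 4 * J + 2 * M ^ 4 * P + 12 * M ^ 3 * Iτ + 4 * M ^ 2 * Q := by
    rw [hGapp]; exact hsplitG
  have hJ : |J| ≤ 4 * Real.pi * m := by
    rw [← hJdef]
    refine abs_sphereIntegral_le fun θ hθ φ hφ ↦ ?_
    obtain ⟨hs, -⟩ := sin_pow_three_le hθ
    have hq : ((θ, φ) : ℝ × ℝ) ∈ Icc (0 : ℝ) Real.pi ×ˢ Icc (0 : ℝ) (2 * Real.pi) := mem_prod.mpr ⟨hθ, hφ⟩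
    have hY' := hmax hq
    have h : |fderiv ℝ (fderiv ℝ Ψ) (horizonPoint M τ θ φ) (horizonNull θ φ) (horizonNull θ φ)| ≤ m := by
      rw [← hmdef]; exact hY'
    rw [abs_mul, abs_of_nonneg hs, mul_comm m]
    exact mul_le_mul_of_nonneg_left h hs
  have hQ : |Q| ≤ 4 * Real.pi * ε := by
    rw [← hQdef]
    refine abs_sphereIntegral_le fun θ hθ φ _ ↦ ?_
    obtain ⟨hs, -⟩ := sin_pow_three_le hθ
    obtain ⟨h0, -, -⟩ := hbd τ hτ' θ φ
    rw [abs_mul, abs_of_nonneg hs, mul_comm ε]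
    exact mul_le_mul_of_nonneg_left h0 hs
  have hIτ : |8 * M ^ 3 * Iτ| ≤ A + A / 4 := by
    have := abs_sub_abs_le_abs_sub (8 * M ^ 3 * Iτ) H
    rw [hAdef] at this
    linarith
  /- Step 9: the lower bound for `|G(τ)|` and the conclusion -/
  have hGlow : A / (2 * M) * (τ - τ₀) - |G τ₀| - A / (8 * M) * (τ - τ₀) ≤ |G τ| := by
    have h := abs_ge_of_abs_sub_add_le (hE2 τ hτ')
    have hc : |H / (2 * M) * (τ - τ₀)| = A / (2 * M) * (τ - τ₀) := by
      rw [abs_mul, abs_div, abs_of_pos (by positivity : (0 : ℝ) < 2 * M), abs_of_nonneg (sub_nonneg.mpr hτ'), hAdef]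
    linarith
  have h8J : |G τ| - K ≤ 8 * M ^ 4 * |J| := by
    have hP' : |2 * M ^ 4 * P| ≤ M ^ 2 / 2 * (4 * Real.pi * (6 * ε) + 4 * Real.pi * (M * (M + 2) * ε)) := by
      have : 2 * M ^ 4 * P = M ^ 2 / 2 * (4 * M ^ 2 * P) := by ring
      rw [this, abs_mul, abs_of_nonneg (by positivity : (0 : ℝ) ≤ M ^ 2 / 2)]
      exact mul_le_mul_of_nonneg_left hE3τ (by positivity)
    have hI' : |12 * M ^ 3 * Iτ| ≤ 3 / 2 * (A + A / 4) := by
      have : 12 * M ^ 3 * Iτ = 3 / 2 * (8 * M ^ 3 * Iτ) := by ring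
      rw [this, abs_mul, abs_of_nonneg (by norm_num : (0 : ℝ) ≤ 3 / 2)]
      exact mul_le_mul_of_nonneg_left hIτ (by norm_num)
    have hQ' : |4 * M ^ 2 * Q| ≤ 4 * M ^ 2 * (4 * Real.pi * ε) := by
      rw [abs_mul, abs_of_nonneg (by positivity : (0 : ℝ) ≤ 4 * M ^ 2)]
      exact mul_le_mul_of_nonneg_left hQ (by positivity)
    have habs : |G τ| ≤ |8 * M ^ 4 * J| + |2 * M ^ 4 * P| + |12 * M ^ 3 * Iτ| + |4 * M ^ 2 * Q| := by
      rw [hGτ]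
      exact (abs_add_le _ _).trans (add_le_add ((abs_add_le _ _).trans (add_le_add (abs_add_le _ _) le_rfl)) le_rfl)
    have h8 : |8 * M ^ 4 * J| = 8 * M ^ 4 * |J| := by
      rw [abs_mul, abs_of_nonneg (by positivity : (0 : ℝ) ≤ 8 * M ^ 4)]
    rw [← hKdef]
    linarith
  -- combine with `τ ≥ τ₁`
  have hmain : A / (8 * M) * τ ≤ 32 * Real.pi * M ^ 4 * m := by
    have h1 : 2 * A / (8 * M) * τ₁ = 3 * A / (8 * M) * τ₀ + (|G τ₀| + K) := by
      rw [← hτ₁def]; field_simp; ring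
    have h2 : 2 * A / (8 * M) * τ₁ ≤ 2 * A / (8 * M) * τ := mul_le_mul_of_nonneg_left hτ (by positivity)
    have h3 : 8 * M ^ 4 * |J| ≤ 8 * M ^ 4 * (4 * Real.pi * m) := mul_le_mul_of_nonneg_left hJ (by positivity)
    have h4 : A / (2 * M) * (τ - τ₀) - A / (8 * M) * (τ - τ₀) = 3 * A / (8 * M) * (τ - τ₀) := by ring
    have h5 : 3 * A / (8 * M) * (τ - τ₀) - |G τ₀| - K - A / (8 * M) * τ =
        2 * A / (8 * M) * τ - (3 * A / (8 * M) * τ₀ + (|G τ₀| + K)) := by ring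
    have h6 : 8 * M ^ 4 * (4 * Real.pi * m) = 32 * Real.pi * M ^ 4 * m := by ring
    linarith [hGlow, h8J]
  have hfin : 1 / (256 * Real.pi * M ^ 5) * A * τ = (A / (8 * M) * τ) / (32 * Real.pi * M ^ 4) := by
    field_simp; ring
  rw [hfin, div_le_iff₀ (by positivity : (0 : ℝ) < 32 * Real.pi * M ^ 4)]
  linarith

end Literature.Barriers.FinalStateConjecture.Kerr

namespace Literature.Barriers.FinalStateConjecture

open Literature.Geometry.Lorentzian

/-! ### Discharge of the `k = 2` clause from the decay fact -/

/-- **Blow-up of the second transversal derivative for axisymmetric solutions (Aretakis 2015,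
Thm. 3, clause `k = 2`, axisymmetric case) follows from the decay of axisymmetric solutions
(Aretakis 2012, Thm. 5) alone** — the conservation law and the second-order horizon identity being
proved. Printed statement (Aretakis, ATMP 19 (2015), Thm. 3): "There exists a constant `c > 0` which
depends only on `M` such that for all solutions to the wave equation on extremal Kerr we have …
• Pointwise blow-up: `sup_{S_τ} |Y^k ψ| ≥ c |H₀[ψ]| τ^{k−1}`, asymptotically along `𝓗⁺` for all
`k ≥ 2`", `Y = ∂_r` in ingoing coordinates `(v, r, θ, φ*)`, `S_τ` the sections of `𝓗⁺ = {r = M}`,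
`H₀[ψ] = H₀^{Kerr}[ψ]` the conserved charge of §5.2. **Conclusion (verbatim the `k = 2` clause of
Theorem 3 as vendored — see `Aretakis2015.scalarInstability_of_facts`,
`ExtremalHorizonInstabilityAssembly.lean`, for the rendering and its itemised deviations — restricted
to axisymmetric solutions, `Kerr.IsAxisymmetric ψ`).** For `M > 0`, `0 < r₀ < M` there is `c > 0`
such that for every open `U ⊇ {r ≥ M} ∩ {t* ≥ 0}` of `Kerr.region M r₀` and every axisymmetric `ψ`
of class `C^∞` on `U` with `□_{g_{M,M}} ψ = 0` on `U` and Cauchy data on `{t* = 0}` supported in a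
coordinate ball: if `H₀[ψ] ≠ 0` (`aretakisCharge`) then there is `τ₁` such that every horizon sphere
`S_τ`, `τ ≥ τ₁`, carries a point with `|YYψ| ≥ c |H₀[ψ]| τ` (`Y = Kerr.transversalDeriv`). (Until the
review of 2026-08-15 this conclusion was the body of the named fact `Aretakis2015_axisymmetricBlowup`
of `ExtremalHorizonAxisymmetricDecay.lean`; it is the hypothesis `hBlow` of
`Aretakis2015.scalarInstability_of_facts` and of `AretakisInstability.of_leafFacts`.) Proof: given an axisymmetric solution `ψ` of the class with `H₀[ψ] ≠ 0`,
replace it by the cutoff average `ψ₀ = ∫₀^{2π} (χψ) ∘ R_α dα` (`Kerr.rotAverage`; a smooth axisymmetric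
solution on a rotation-invariant open set `⊇ {r ≥ M} ∩ {t* ≥ 0}` with localised data, globally
represented, `H₀[ψ₀] = 2π H₀[ψ]`), apply the core estimate `Kerr.secondDeriv_blowup_core`
(`|YYψ₀| ≥ |H₀[ψ₀]| τ/(256πM⁵)` somewhere on `S_τ` for `τ ≥ τ₁`), and transfer the bound to `ψ` along
the orbit (`YYψ₀ = ∫ (YYψ) ∘ R_α`, `S_τ` is `R_α`-invariant). The constant is `c = 1/(256 π M⁵)`.
[cite: Aretakis2015, Thm. 3 (k = 2) and Thm. 2; Aretakis2012, Thm. 5] -/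
theorem Aretakis2015.axisymmetricBlowup_of_decay (hDec : Aretakis2012_pointwiseDecay) :
    ∀ [Kerr.Facts] [Kerr.SliceFacts] (M : ℝ), 0 < M → ∀ r₀ ∈ Set.Ioo 0 M,
      ∃ c > (0 : ℝ), ∀ (U : Set (Kerr.region M r₀)) (ψ : Kerr.region M r₀ → ℝ),
        IsOpen U →
        {x : Kerr.region M r₀ | Kerr.rPlus M M ≤ Kerr.radius M (x : E4) ∧ 0 ≤ (x : E4) 0} ⊆ U →
        ContMDiffOn 𝓘(ℝ, E4) 𝓘(ℝ, ℝ) ∞ ψ U →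
        (∀ x ∈ U, (Kerr.smoothMetric M M r₀).toPseudoRiemannianMetric.dalembertian ψ x = 0) →
        (∃ ρ : ℝ, ∀ x ∈ U, (x : E4) 0 = 0 → ρ < E4.spatialNorm (x : E4) →
          ψ x = 0 ∧ mfderiv 𝓘(ℝ, E4) 𝓘(ℝ, ℝ) ψ x = 0) →
        Kerr.IsAxisymmetric ψ →
        aretakisCharge M r₀ ψ ≠ 0 →
        ∃ τ₁ : ℝ, ∀ τ : ℝ, τ₁ ≤ τ →
          ∃ x ∈ Kerr.horizonSection M M r₀ τ,
            c * |aretakisCharge M r₀ ψ| * τ ≤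
              |Kerr.transversalDeriv M r₀ (Kerr.transversalDeriv M r₀ ψ) x| := by
  intro _ _ M hM r₀ hr₀
  obtain ⟨hr₀pos, hr₀M⟩ := hr₀
  have hπ := Real.pi_pos
  refine ⟨1 / (256 * Real.pi * M ^ 5), by positivity, ?_⟩
  intro U ψ hU hKU hψ hsol hloc _ hH
  obtain ⟨ρ, hρ⟩ := hloc
  /- Step 1: the representative, the open set over `U`, the cutoff -/
  set Ψ : E4 → ℝ := Function.extend Subtype.val ψ 0 with hΨdef
  have hrep : ∀ y : Kerr.region M r₀, ψ y = Ψ y := Kerr.extend_apply_coe ψ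
  set V : Set E4 := Subtype.val '' U with hVdef
  have hV : IsOpen V := (Kerr.region M r₀).isOpen.isOpenMap_subtype_val U hU
  have hΨV : ∀ x ∈ V, ContDiffAt ℝ ∞ Ψ x := by
    rintro x ⟨y, hyU, rfl⟩
    exact (OpensChart.contMDiffAt_iff y ψ Ψ hrep).mp (hψ.contMDiffAt (hU.mem_nhds hyU))
  have hVpos : ∀ z ∈ V, 0 < Kerr.radius M z := by
    rintro _ ⟨y, _, rfl⟩; exact Kerr.radius_pos_of_mem_region y.2
  set K' : Set E4 := {x : E4 | Kerr.rPlus M M ≤ Kerr.radius M x ∧ 0 ≤ x 0} with hK'def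
  have hK'c : IsClosed K' := Kerr.isClosed_horizonFutureSet M M
  have hK'reg : ∀ x ∈ K', x ∈ Kerr.region M r₀ := by
    intro x hx
    rw [Kerr.mem_region]
    have h1 : Kerr.rPlus M M ≤ Kerr.radius M x := hx.1
    rw [Kerr.rPlus_self] at h1
    exact max_lt (by linarith) (by linarith)
  have hK'V : K' ⊆ V := fun x hx ↦ ⟨⟨x, hK'reg x hx⟩, hKU hx, rfl⟩
  obtain ⟨χ, N, hχ, hN, hKN, hNV, hχ1, hχsupp⟩ := Kerr.exists_smooth_cutoff hK'c hV hK'V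
  set G : E4 → ℝ := fun z ↦ χ z * Ψ z with hGdef
  have hG : ContDiff ℝ ∞ G := Kerr.contDiff_cutoff_mul hχ hχsupp hΨV
  have hGN : EqOn G Ψ N := fun z hz ↦ by
    show χ z * Ψ z = Ψ z
    rw [hχ1 z hz, one_mul]
  have hNU : ∀ z ∈ N, ∃ hz : z ∈ Kerr.region M r₀, (⟨z, hz⟩ : Kerr.region M r₀) ∈ U := by
    intro z hz
    obtain ⟨y, hyU, hyz⟩ := hNV hz
    subst hyz
    exact ⟨y.2, hyU⟩
  have hGsupp : tsupport G ⊆ V := by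
    refine (closure_mono fun z hz ↦ ?_).trans hχsupp
    intro h0
    exact hz (by simp [hGdef, h0])
  /- the rotation-invariant open set `U₀ ⊆ U` containing `K` -/
  set U₀ : Set (Kerr.region M r₀) := {x | ∀ α : ℝ, E4.axialRotation α x ∈ N} with hU₀def
  have hU₀ : IsOpen U₀ :=
    (Kerr.isOpen_setOf_forall_axialRotation_mem hN).preimage continuous_subtype_val
  have hKU₀ : {x : Kerr.region M r₀ | Kerr.rPlus M M ≤ Kerr.radius M (x : E4) ∧ 0 ≤ (x : E4) 0} ⊆ U₀ := by
    intro x hx α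
    exact hKN (Kerr.axialRotation_mem_horizonFutureSet_iff.mpr hx)
  have hU₀N : ∀ x ∈ U₀, ∀ α, E4.axialRotation α (x : E4) ∈ N := fun x hx ↦ hx
  /- Step 2: the averaged solution `ψ₀` -/
  set Ψ₀ : E4 → ℝ := Kerr.rotAverage G with hΨ₀def
  have hΨ₀ : ContDiff ℝ ∞ Ψ₀ := Kerr.contDiff_rotAverage hG
  set ψ₀ : Kerr.region M r₀ → ℝ := fun y ↦ Ψ₀ y with hψ₀def
  have hsol₀ : ∀ x ∈ U₀, (Kerr.smoothMetric M M r₀).toPseudoRiemannianMetric.dalembertian ψ₀ x = 0 :=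
    fun x hx ↦ Kerr.dalembertian_rotAverage_eq_zero hU hψ hsol hG hN hNU hGN x (hU₀N x hx)
  have hloc₀' : ∀ x ∈ U₀, (x : E4) 0 = 0 → ρ < E4.spatialNorm (x : E4) →
      Ψ₀ x = 0 ∧ fderiv ℝ Ψ₀ x = 0 := by
    intro x hx hx0 hxρ
    have hzero : ∀ α, Ψ (E4.axialRotation α x) = 0 ∧
        fderiv ℝ Ψ (E4.axialRotation α x) = 0 := by
      intro α
      obtain ⟨hz, hzU⟩ := hNU _ (hU₀N x hx α)
      have h := hρ ⟨_, hz⟩ hzU (by simp [hx0]) (by simpa [E4.spatialNorm_axialRotation] using hxρ)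
      have hd : DifferentiableAt ℝ Ψ (E4.axialRotation α x) :=
        ((OpensChart.contMDiffAt_iff ⟨_, hz⟩ ψ Ψ hrep).mp (hψ.contMDiffAt (hU.mem_nhds hzU))).differentiableAt
          (WithTop.coe_ne_zero.mpr ENat.top_ne_zero)
      refine ⟨by rw [← hrep ⟨_, hz⟩]; exact h.1, ?_⟩
      rw [← OpensChart.mfderiv_eq ⟨_, hz⟩ ψ Ψ hrep hd]
      exact h.2
    have hz1 : ∀ α, Ψ (E4.axialRotation α x) = 0 := fun α ↦ (hzero α).1
    have hz2 : ∀ α, fderiv ℝ Ψ (E4.axialRotation α x) = 0 := fun α ↦ (hzero α).2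
    constructor
    · show Kerr.rotAverage G x = 0
      rw [Kerr.rotAverage_apply_of_forall_mem hGN (hU₀N x hx)]
      simp only [hz1, intervalIntegral.integral_zero]
    · ext v
      rw [Kerr.fderiv_rotAverage_apply_of_forall_mem hG hN hGN (hU₀N x hx)]
      simp only [hz2, _root_.zero_apply, intervalIntegral.integral_zero]
  have haxi₀ : ∀ β (x : E4), Ψ₀ (E4.axialRotation β x) = Ψ₀ x := fun β x ↦ Kerr.rotAverage_axialRotation G β x
  /- Step 3: the charge of the average -/
  have hΨc : ContinuousOn Ψ V := fun x hx ↦ (hΨV x hx).continuousAt.continuousWithinAt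
  have hΨon : ContDiffOn ℝ 2 Ψ V := fun x hx ↦ ((hΨV x hx).of_le (WithTop.coe_le_coe.mpr le_top)).contDiffWithinAt
  have hLc : ContinuousOn (fderiv ℝ Ψ) V := hΨon.continuousOn_fderiv_of_isOpen hV (by norm_num)
  have hPV : ∀ σ θ φ, 0 ≤ σ → Kerr.horizonPoint M σ θ φ ∈ V := by
    intro σ θ φ hσ
    refine hK'V ⟨?_, ?_⟩
    · show Kerr.rPlus M M ≤ Kerr.radius M (Kerr.horizonPoint M σ θ φ)
      rw [Kerr.rPlus_self, Kerr.radius_horizonPoint hM.le]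
    · show 0 ≤ Kerr.horizonPoint M σ θ φ 0
      rwa [Kerr.horizonPoint_apply_zero]
  have hPN : ∀ σ θ φ, 0 ≤ σ → Kerr.horizonPoint M σ θ φ ∈ N := by
    intro σ θ φ hσ
    refine hKN ⟨?_, ?_⟩
    · show Kerr.rPlus M M ≤ Kerr.radius M (Kerr.horizonPoint M σ θ φ)
      rw [Kerr.rPlus_self, Kerr.radius_horizonPoint hM.le]
    · show 0 ≤ Kerr.horizonPoint M σ θ φ 0
      rwa [Kerr.horizonPoint_apply_zero]
  have hdens₀ : ∀ θ φ, Kerr.densityFun M Ψ₀ 0 θ φ =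
      ∫ α in (0 : ℝ)..2 * Real.pi, Kerr.densityFun M Ψ 0 θ (φ + α) := by
    intro θ φ
    have hP0 : Continuous fun β : ℝ ↦ Kerr.horizonPoint M 0 θ β := by
      simp only [Kerr.horizonPoint_eq_toLp]
      refine Kerr.continuous_toLp_four ?_ ?_ ?_ ?_ <;> fun_prop
    have hP0V : ∀ β, Kerr.horizonPoint M 0 θ β ∈ V := fun β ↦ hPV 0 θ β le_rfl
    have hN0 : Continuous fun β : ℝ ↦ Kerr.horizonNull θ β := by
      simp only [Kerr.horizonNull]
      refine Kerr.continuous_toLp_four ?_ ?_ ?_ ?_ <;> fun_prop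
    exact Kerr.densityFun_rotAverage hM hG hN hGN (fun α ↦ hPN 0 θ (φ + α) le_rfl)
      (hΨc.comp_continuous hP0 hP0V)
      ((hLc.comp_continuous hP0 hP0V).clm_apply continuous_const)
      ((hLc.comp_continuous hP0 hP0V).clm_apply hN0)
  have hH₀ : aretakisCharge M r₀ ψ₀ = 2 * Real.pi * aretakisCharge M r₀ ψ := by
    rw [Kerr.aretakisCharge_of_rep hM hr₀M Ψ₀, Kerr.aretakisCharge_eq_sphereIntegral_densityFun ψ]
    refine Kerr.sphereIntegral_of_orbitIntegral hdens₀ ?_ fun θ φ ↦ Kerr.densityFun_add_two_pi M Ψ 0 θ φ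
    exact Kerr.continuous_densityFun_angles hM hΨc hLc hPV le_rfl
  have hH₀ne : aretakisCharge M r₀ ψ₀ ≠ 0 := by
    rw [hH₀]; exact mul_ne_zero (by positivity) hH
  /- Step 4: the core estimate for `Ψ₀` and the transfer to `ψ` -/
  obtain ⟨τ₁, hτ₁0, hcore⟩ := Kerr.secondDeriv_blowup_core hDec hM ⟨hr₀pos, hr₀M⟩ hU₀ hKU₀ hΨ₀ hsol₀
    hloc₀' haxi₀ hH₀ne
  refine ⟨τ₁, fun τ hτ ↦ ?_⟩
  have hτ0 : 0 ≤ τ := hτ₁0.trans hτ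
  obtain ⟨θ, φ, hθφ⟩ := hcore τ hτ
  -- the point of `S_τ`
  have hp : Kerr.horizonPoint M τ θ φ ∈ Kerr.region M r₀ := Kerr.horizonPoint_mem_region hM hr₀M τ θ φ
  set x : Kerr.region M r₀ := ⟨_, hp⟩ with hxdef
  have hxS : x ∈ Kerr.horizonSection M M r₀ τ := by
    rw [Kerr.mem_horizonSection]
    exact ⟨by rw [Kerr.rPlus_self]; exact Kerr.radius_horizonPoint hM.le τ θ φ, Kerr.horizonPoint_apply_zero M τ θ φ⟩
  have hxU₀ : x ∈ U₀ := hKU₀ ⟨hxS.1.ge, by rw [hxS.2]; exact hτ0⟩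
  have hSrot : ∀ α, Kerr.axialRotate M r₀ α x ∈ Kerr.horizonSection M M r₀ τ := fun α ↦
    Kerr.axialRotate_mem_horizonSection_iff.mpr hxS
  -- `YYψ₀ x = D²Ψ₀(p)(ℓ♯, ℓ♯)` and `= ∫ (YYψ) ∘ R_α`
  have hYY : Kerr.transversalDeriv M r₀ (Kerr.transversalDeriv M r₀ ψ₀) x =
      fderiv ℝ (fderiv ℝ Ψ₀) (Kerr.horizonPoint M τ θ φ) (Kerr.horizonNull θ φ) (Kerr.horizonNull θ φ) := by
    rw [hψ₀def, Kerr.transversalDeriv_transversalDeriv_of_rep hΨ₀ x]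
    show fderiv ℝ (fderiv ℝ Ψ₀) (Kerr.horizonPoint M τ θ φ) (Kerr.nullVector M (Kerr.horizonPoint M τ θ φ))
      (Kerr.nullVector M (Kerr.horizonPoint M τ θ φ)) = _
    rw [Kerr.nullVector_horizonPoint hM]
  have horb := Kerr.transversalDeriv_transversalDeriv_rotAverage_eq_orbitIntegral hU hψ hG hGsupp hVpos hN hNU
    hGN x (hU₀N x hxU₀)
  rw [← hYY, hψ₀def, hΨ₀def, horb] at hθφ
  -- continuity along the orbit
  set YG : E4 → ℝ := fun w ↦ fderiv ℝ G w (Kerr.nullVector M w) with hYGdef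
  have hYG : ContDiff ℝ ∞ YG := Kerr.contDiff_transversalFun hG hGsupp hVpos
  set YYG : E4 → ℝ := fun w ↦ fderiv ℝ YG w (Kerr.nullVector M w) with hYYGdef
  have hYYG : ContDiff ℝ ∞ YYG := Kerr.contDiff_transversalFun hYG
    ((Kerr.tsupport_transversalFun_subset G).trans hGsupp) hVpos
  have hYYorb : ∀ α, Kerr.transversalDeriv M r₀ (Kerr.transversalDeriv M r₀ ψ)
      (Kerr.axialRotate M r₀ α x) = YYG (E4.axialRotation α x) := by
    intro α
    obtain ⟨hz', h⟩ := Kerr.transversalDeriv_transversalDeriv_eq_of_cutoff hU hψ hN hNU hGN (hU₀N x hxU₀ α)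
    exact h
  have hcont : Continuous fun α ↦ Kerr.transversalDeriv M r₀ (Kerr.transversalDeriv M r₀ ψ)
      (Kerr.axialRotate M r₀ α x) := by
    simp only [hYYorb]
    exact hYYG.continuous.comp (Kerr.continuous_axialRotation_apply (x : E4))
  -- transfer
  have hge : 2 * Real.pi * (1 / (256 * Real.pi * M ^ 5) * |aretakisCharge M r₀ ψ| * τ) ≤
      |∫ α in (0 : ℝ)..2 * Real.pi, Kerr.transversalDeriv M r₀ (Kerr.transversalDeriv M r₀ ψ)
        (Kerr.axialRotate M r₀ α x)| := by
    have : 1 / (256 * Real.pi * M ^ 5) * |aretakisCharge M r₀ (fun y : Kerr.region M r₀ ↦ Ψ₀ y)| * τ =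
        2 * Real.pi * (1 / (256 * Real.pi * M ^ 5) * |aretakisCharge M r₀ ψ| * τ) := by
      show 1 / (256 * Real.pi * M ^ 5) * |aretakisCharge M r₀ ψ₀| * τ = _
      rw [hH₀, abs_mul, abs_of_pos (by positivity : (0 : ℝ) < 2 * Real.pi)]; ring
    rw [← this]
    exact hθφ
  obtain ⟨α, -, hα⟩ := Kerr.exists_le_abs_of_le_abs_integral hcont hge
  exact ⟨Kerr.axialRotate M r₀ α x, hSrot α, hα⟩

/-- **Aretakis's Theorem 3 (clauses `k = 1, 2`, universal asymptotic form, as vendored) follows from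
the decay of axisymmetric solutions alone** (Aretakis 2012, Thm. 5; named fact
`Aretakis2012_pointwiseDecay`): the conservation law (`Aretakis2015_chargeConservation_holds`), the
projection to the zeroth azimuthal frequency (`ExtremalHorizonAxisymmetricProjection.lean`), and the
second-order horizon identity with the blow-up mechanism of Thm. 2
(`ExtremalHorizonSecondOrderIdentity.lean`, this file) are proved. The conclusion is verbatim that of
`Aretakis2015.scalarInstability_of_facts` (`ExtremalHorizonInstabilityAssembly.lean`, where the
printed statement, the rendering and its itemised deviations are documented) — until the review of
2026-08-15 the body of the named fact `Aretakis2015_scalarInstability`, whose discharge this theorem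
is modulo the leaf: `Aretakis2015.scalarInstability_of_decay Aretakis2012_pointwiseDecay_holds`.
[cite: Aretakis2015, Thm. 3 and Thm. 2; Aretakis2012, Thm. 5] -/
theorem Aretakis2015.scalarInstability_of_decay (hDec : Aretakis2012_pointwiseDecay) :
    ∀ [Kerr.Facts] [Kerr.SliceFacts] (M : ℝ), 0 < M → ∀ r₀ ∈ Set.Ioo 0 M,
      ∃ c > (0 : ℝ), ∀ (U : Set (Kerr.region M r₀)) (ψ : Kerr.region M r₀ → ℝ),
        IsOpen U →
        {x : Kerr.region M r₀ | Kerr.rPlus M M ≤ Kerr.radius M (x : E4) ∧ 0 ≤ (x : E4) 0} ⊆ U →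
        ContMDiffOn 𝓘(ℝ, E4) 𝓘(ℝ, ℝ) ∞ ψ U →
        (∀ x ∈ U, (Kerr.smoothMetric M M r₀).toPseudoRiemannianMetric.dalembertian ψ x = 0) →
        (∃ ρ : ℝ, ∀ x ∈ U, (x : E4) 0 = 0 → ρ < E4.spatialNorm (x : E4) →
          ψ x = 0 ∧ mfderiv 𝓘(ℝ, E4) 𝓘(ℝ, ℝ) ψ x = 0) →
        aretakisCharge M r₀ ψ ≠ 0 →
        ∃ τ₁ : ℝ, ∀ τ : ℝ, τ₁ ≤ τ →
          (∃ x ∈ Kerr.horizonSection M M r₀ τ,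
            c * |aretakisCharge M r₀ ψ| ≤ |Kerr.transversalDeriv M r₀ ψ x|) ∧
          (∃ x ∈ Kerr.horizonSection M M r₀ τ,
            c * |aretakisCharge M r₀ ψ| * τ ≤
              |Kerr.transversalDeriv M r₀ (Kerr.transversalDeriv M r₀ ψ) x|) :=
  Aretakis2015.scalarInstability_of_facts hDec (Aretakis2015.axisymmetricBlowup_of_decay hDec)

end Literature.Barriers.FinalStateConjecture

end
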